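import Literature.Analysis.Complex.SelbergBoxLemma
import Literature.Analysis.Complex.ArgumentPrincipleEdgeZeros
import HarnessLib

/-!
# Selberg's box lemma — proof layer (Conrey–Soundararajan 2002, Lemma 2.1)

Topic `Literature/Analysis/Complex` (namespace `Literature.Analysis.Complex.SelbergBox`). PROOF
LAYER for the statement file `SelbergBoxLemma.lean` (named fact
`Literature.Analysis.Complex.selbergBoxLemma`, Conrey–Soundararajan 2002 §2 Lemma 2.1, "due to
Selberg"). Everything here is PROVED; no definitions, no named facts.

## Main results

* `Literature.Analysis.Complex.SelbergBox.identity_of_ne_zero_on_boundary` — **Lemma 2.1 for a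
  zero-free boundary**: for `f` analytic at every point of the closed box `[W₀, W₁] × [−H, H]`
  (`H > 0`, `W₀ < W₁`), non-zero on its four edges, and any continuous branch `Λ` of
  `log f(W₁ + it)` on `[−H, H]`,
  `4H Σ_{ρ ∈ 𝓑, f(ρ)=0} m(ρ) cos(πγ/(2H)) sinh(π(β − W₀)/(2H))`
  `= ∫_{−H}^{H} cos(πt/(2H)) log|f(W₀+it)| dt + ∫_{W₀}^{W₁} sinh(π(α−W₀)/(2H)) log|f(α+iH) f(α−iH)| dα`
  `  − Re ∫_{−H}^{H} cos(π(W₁ − W₀ + it)/(2iH)) Λ(t) dt`,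
  i.e. exactly the right-hand side of `selbergBoxLemma` (same `SelbergBox.weight`,
  `SelbergBox.rightKernel`).
* `Literature.Analysis.Complex.SelbergBox.identity_split_aux` — the same identity, with the
  horizontal term split as `∫ sinh · log|f(α+iH)| + ∫ sinh · log|f(α−iH)|`, for `f` analytic on the
  closed box and non-zero on the RIGHT edge only: zeros on the other three edges are allowed (they
  carry Selberg weight `0`; the edge integrals of `log |f|` are then absolutely convergent improper
  integrals, and their integrability is part of the conclusion). Proof by induction on the boundary
  zeros: divide out `(s − ρ)^{m(ρ)}`; for the linear factor the identity
  (`SelbergBox.linear_rhs_eq_zero_of_mem_frontier`) follows from the zero-free case at points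
  `ρₙ → ρ` outside the box by dominated convergence (majorant `|log |t − γ|| + const` along the
  outward normal).
* `Literature.Analysis.Complex.selbergBoxLemma_holds` — **the DISCHARGE** of the named fact
  `selbergBoxLemma` (statement file untouched): `theorem selbergBoxLemma_holds : selbergBoxLemma`.

## Proof (the printed argument, p0001:L112–L150 of the held text `paper:arxiv-math_0111013`, in
the branch-free language of the tree's `LittlewoodLemma.lean`)

Conrey–Soundararajan integrate `cos(π(s − W₀)/(2iH)) log f(s)` over the boundary of the box cut
along horizontal segments from the left edge to each zero. Equivalently (integration by parts),
apply the tree's weighted argument principle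
`Literature.Analysis.Complex.integral_boundary_rect_logDeriv_mul` (`WeightedArgumentPrinciple.lean`)
with the PRIMITIVE weight `G(s) = (2iH/π) sin(π(s − W₀)/(2iH))` of Selberg's kernel
`g(s) = cos(π(s − W₀)/(2iH))`: `∮ (f'/f) G = 2πi Σ m(ρ) G(ρ)`, and `Re G(β+iγ) = (2H/π)·weight`.
Then integrate by parts on each edge against the edge primitives of `f'/f`
(`integral_mul_weight_horizontal'`, `integral_mul_weight_vertical'`; the tree's
`re_integral_logDeriv_horizontal` / `im_integral_logDeriv_vertical` identify their real resp.
imaginary parts with `log |f|`), and take imaginary parts. Writing `s = x + yi`,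
`p = πy/(2H)`, `q = π(x − W₀)/(2H)`: `g = cos p cosh q + i sin p sinh q`,
`G = (2H/π)(cos p sinh q + i sin p cosh q)` (`kernel_apply`, `primKernel_apply`); so `g` is REAL
on the left edge (`q = 0`) and PURELY IMAGINARY on the horizontal edges (`p = ±π/2`), and `G` is
purely imaginary at the three corners `W₀ ± iH`, `W₁ + iH` that enter — this is what makes
`log |f|` (not `log f`) appear on three sides. On the right edge a given continuous branch `Λ` of
`log f(W₁ + it)` equals `Λ(−H) + i ∫_{−H}^{t} (f'/f)(W₁ + iu) du` (`exp_I_mul_primitive_vertical`: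
the derivative of `f · exp(−i ∫ f'/f)` vanishes; `branch_sub_eq`: two continuous logarithms on a
segment differ by a constant, by the intermediate value theorem applied to `|Λ₁ − Λ₂|`), and
`∫_{−H}^{H} cos(π(W₁ − W₀ + it)/(2iH)) dt = (4H/π) cosh(π(W₁ − W₀)/(2H))` is real
(`integral_rightKernel`), so `Re Λ(−H) = log |f(W₁ − iH)|` is all that the branch contributes.

## References

* [ConreySoundararajan2002] J. B. Conrey, K. Soundararajan, *Real zeros of quadratic Dirichlet
  `L`-functions*, Invent. Math. 150 (2002) 1–44 = arXiv:math/0111013, §2, Lemma 2.1 with proof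
  (held text p0001:L89–L150).
* A. Selberg, *Contributions to the theory of Dirichlet's `L`-functions*, Skr. Norske Vid.-Akad.
  Oslo I, 1946, no. 3, 1–62 (the original; cited through [ConreySoundararajan2002, ref. 10]).
* E. C. Titchmarsh, *The Theory of the Riemann Zeta-Function*, 2nd ed. (1986), §9.9 (Littlewood's
  lemma — the tree's model `Literature.Analysis.Complex.littlewood_lemma`). [Titchmarsh1986]
-/

noncomputable section

open Complex Set MeasureTheory Filter Topology intervalIntegral

namespace Literature.Analysis.Complex

namespace SelbergBox

/-! ### Trigonometric bookkeeping for Selberg's kernel -/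

/-- `cos(p − qI) = cos p cosh q + (sin p sinh q) I` for real `p, q`. [folklore] -/
private theorem cos_ofReal_sub_mul_I (p q : ℝ) :
    Complex.cos ((p : ℂ) - q * I) =
      ((Real.cos p * Real.cosh q : ℝ) : ℂ) + ((Real.sin p * Real.sinh q : ℝ) : ℂ) * I := by
  rw [sub_eq_add_neg, ← neg_mul, ← ofReal_neg, Complex.cos_add, Complex.cos_mul_I,
    Complex.sin_mul_I]
  push_cast
  rw [Complex.cosh_neg, Complex.sinh_neg]
  ring

/-- `sin(p − qI) = sin p cosh q − (cos p sinh q) I` for real `p, q`. [folklore] -/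
private theorem sin_ofReal_sub_mul_I (p q : ℝ) :
    Complex.sin ((p : ℂ) - q * I) =
      ((Real.sin p * Real.cosh q : ℝ) : ℂ) - ((Real.cos p * Real.sinh q : ℝ) : ℂ) * I := by
  rw [sub_eq_add_neg, ← neg_mul, ← ofReal_neg, Complex.sin_add, Complex.cos_mul_I,
    Complex.sin_mul_I]
  push_cast
  rw [Complex.cosh_neg, Complex.sinh_neg]
  ring

/-- The argument of Selberg's kernel at `s = x + yI`:
`π((x + yI) − a)/(2IH) = πy/(2H) − (π(x − a)/(2H)) I`. [folklore] -/
private theorem kernelArg_eq {H : ℝ} (hH : H ≠ 0) (a x y : ℝ) :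
    (Real.pi : ℂ) * (((x : ℂ) + y * I) - a) / (2 * I * H) =
      ((Real.pi * y / (2 * H) : ℝ) : ℂ) - ((Real.pi * (x - a) / (2 * H) : ℝ) : ℂ) * I := by
  have hH' : (H : ℂ) ≠ 0 := ofReal_ne_zero.mpr hH
  have h2 : (2 : ℂ) * I * H ≠ 0 := mul_ne_zero (mul_ne_zero two_ne_zero I_ne_zero) hH'
  rw [div_eq_iff h2]
  push_cast
  have h2H : (2 : ℂ) * H ≠ 0 := mul_ne_zero two_ne_zero hH'
  field_simp
  ring_nf
  rw [I_sq]
  ring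


/-- Selberg's kernel `cos(π(s − a)/(2IH))` at `s = x + yI`, in real and imaginary parts
(`p = πy/(2H)`, `q = π(x − a)/(2H)`): `cos p cosh q + (sin p sinh q) I`. [folklore] -/
private theorem kernel_apply {H : ℝ} (hH : H ≠ 0) (a x y : ℝ) :
    Complex.cos ((Real.pi : ℂ) * (((x : ℂ) + y * I) - a) / (2 * I * H)) =
      ((Real.cos (Real.pi * y / (2 * H)) * Real.cosh (Real.pi * (x - a) / (2 * H)) : ℝ) : ℂ) +
        ((Real.sin (Real.pi * y / (2 * H)) * Real.sinh (Real.pi * (x - a) / (2 * H)) : ℝ) : ℂ) *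
          I := by
  rw [kernelArg_eq hH, cos_ofReal_sub_mul_I]

/-- The primitive `(2IH/π) sin(π(s − a)/(2IH))` of Selberg's kernel at `s = x + yI`:
`(2H/π)(cos p sinh q) + (2H/π)(sin p cosh q) I`. [folklore] -/
private theorem primKernel_apply {H : ℝ} (hH : H ≠ 0) (a x y : ℝ) :
    2 * I * H / Real.pi * Complex.sin ((Real.pi : ℂ) * (((x : ℂ) + y * I) - a) / (2 * I * H)) =
      ((2 * H / Real.pi * (Real.cos (Real.pi * y / (2 * H)) *
          Real.sinh (Real.pi * (x - a) / (2 * H))) : ℝ) : ℂ) +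
        ((2 * H / Real.pi * (Real.sin (Real.pi * y / (2 * H)) *
          Real.cosh (Real.pi * (x - a) / (2 * H))) : ℝ) : ℂ) * I := by
  rw [kernelArg_eq hH, sin_ofReal_sub_mul_I]
  push_cast
  ring_nf
  rw [I_sq]
  ring

/-- The primitive `G(s) = (2IH/π) sin(π(s − a)/(2IH))` has derivative Selberg's kernel
`cos(π(s − a)/(2IH))`. [folklore] -/
private theorem hasDerivAt_primKernel {H : ℝ} (hH : H ≠ 0) (a : ℝ) (z : ℂ) :
    HasDerivAt (fun s : ℂ ↦ 2 * I * H / Real.pi * Complex.sin ((Real.pi : ℂ) * (s - a) / (2 * I * H)))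
      (Complex.cos ((Real.pi : ℂ) * (z - a) / (2 * I * H))) z := by
  have hH' : (H : ℂ) ≠ 0 := ofReal_ne_zero.mpr hH
  have h2 : (2 : ℂ) * I * H ≠ 0 := mul_ne_zero (mul_ne_zero two_ne_zero I_ne_zero) hH'
  have hπ : (Real.pi : ℂ) ≠ 0 := ofReal_ne_zero.mpr Real.pi_ne_zero
  have h1 : HasDerivAt (fun s : ℂ ↦ (Real.pi : ℂ) * (s - a) / (2 * I * H))
      ((Real.pi : ℂ) * 1 / (2 * I * H)) z :=
    (((hasDerivAt_id z).sub_const (a : ℂ)).const_mul (Real.pi : ℂ)).div_const (2 * I * H)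
  have h3 := ((Complex.hasDerivAt_sin _).comp z h1).const_mul (2 * I * H / Real.pi)
  have key : 2 * I * H / Real.pi *
      (Complex.cos ((Real.pi : ℂ) * (z - a) / (2 * I * H)) * ((Real.pi : ℂ) * 1 / (2 * I * H))) =
      Complex.cos ((Real.pi : ℂ) * (z - a) / (2 * I * H)) := by
    field_simp
  rw [key] at h3
  exact h3

/-- On the left edge `s = a + yI` Selberg's kernel is the real number `cos(πy/(2H))`.
[folklore] -/
private theorem kernel_left {H : ℝ} (hH : H ≠ 0) (a y : ℝ) :
    Complex.cos ((Real.pi : ℂ) * (((a : ℂ) + y * I) - a) / (2 * I * H)) =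
      ((Real.cos (Real.pi * y / (2 * H)) : ℝ) : ℂ) := by
  rw [kernel_apply hH]
  simp

/-- On the top edge `s = x + HI` Selberg's kernel is `sinh(π(x − a)/(2H)) · I`. [folklore] -/
private theorem kernel_top {H : ℝ} (hH : H ≠ 0) (a x : ℝ) :
    Complex.cos ((Real.pi : ℂ) * (((x : ℂ) + H * I) - a) / (2 * I * H)) =
      ((Real.sinh (Real.pi * (x - a) / (2 * H)) : ℝ) : ℂ) * I := by
  have h : Real.pi * H / (2 * H) = Real.pi / 2 := by field_simp
  rw [kernel_apply hH, h]
  simp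

/-- On the bottom edge `s = x − HI` Selberg's kernel is `−sinh(π(x − a)/(2H)) · I`.
[folklore] -/
private theorem kernel_bot {H : ℝ} (hH : H ≠ 0) (a x : ℝ) :
    Complex.cos ((Real.pi : ℂ) * (((x : ℂ) + (-H : ℝ) * I) - a) / (2 * I * H)) =
      -((Real.sinh (Real.pi * (x - a) / (2 * H)) : ℝ) : ℂ) * I := by
  have h : Real.pi * (-H) / (2 * H) = -(Real.pi / 2) := by field_simp
  rw [kernel_apply hH, h]
  simp

/-- `G(a + HI) = 2IH/π`. [folklore] -/
private theorem primKernel_left_top {H : ℝ} (hH : H ≠ 0) (a : ℝ) :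
    2 * I * H / Real.pi * Complex.sin ((Real.pi : ℂ) * (((a : ℂ) + H * I) - a) / (2 * I * H)) =
      ((2 * H / Real.pi : ℝ) : ℂ) * I := by
  have h : Real.pi * H / (2 * H) = Real.pi / 2 := by field_simp
  rw [primKernel_apply hH, h]
  simp only [sub_self, mul_zero, zero_div, Real.sinh_zero, Real.cosh_zero, Real.cos_pi_div_two,
    Real.sin_pi_div_two, mul_one, ofReal_zero, zero_add]

/-- `G(a − HI) = −2IH/π`. [folklore] -/
private theorem primKernel_left_bot {H : ℝ} (hH : H ≠ 0) (a : ℝ) :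
    2 * I * H / Real.pi *
        Complex.sin ((Real.pi : ℂ) * (((a : ℂ) + (-H : ℝ) * I) - a) / (2 * I * H)) =
      -(((2 * H / Real.pi : ℝ) : ℂ) * I) := by
  have h : Real.pi * (-H) / (2 * H) = -(Real.pi / 2) := by field_simp
  rw [primKernel_apply hH, h]
  simp only [sub_self, mul_zero, zero_div, Real.sinh_zero, Real.cosh_zero, Real.cos_neg,
    Real.sin_neg, Real.cos_pi_div_two, Real.sin_pi_div_two, mul_one, ofReal_zero, zero_add,
    mul_neg_one, neg_mul, ofReal_neg]

/-- `G(b + HI) = (2H/π) cosh(π(b − a)/(2H)) · I`. [folklore] -/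
private theorem primKernel_right_top {H : ℝ} (hH : H ≠ 0) (a b : ℝ) :
    2 * I * H / Real.pi * Complex.sin ((Real.pi : ℂ) * (((b : ℂ) + H * I) - a) / (2 * I * H)) =
      ((2 * H / Real.pi * Real.cosh (Real.pi * (b - a) / (2 * H)) : ℝ) : ℂ) * I := by
  have h : Real.pi * H / (2 * H) = Real.pi / 2 := by field_simp
  rw [primKernel_apply hH, h]
  simp

/-- The real part of `G(ρ)` is `(2H/π)` times Selberg's zero weight. [folklore] -/
private theorem primKernel_re {H : ℝ} (hH : H ≠ 0) (a : ℝ) (ρ : ℂ) :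
    (2 * I * H / Real.pi * Complex.sin ((Real.pi : ℂ) * (ρ - a) / (2 * I * H))).re =
      2 * H / Real.pi * weight a H ρ := by
  conv_lhs => rw [← re_add_im ρ]
  rw [primKernel_apply hH]
  simp only [add_re, ofReal_re, mul_re, I_re, mul_zero, ofReal_im, I_im, mul_one, sub_self,
    add_zero, weight]


/-! ### Integration by parts along the edges against a general weight -/

variable {a b c d : ℝ}

/-- **Integration by parts on a horizontal edge**, general weight: for `F`, `g` continuous at every
point of `[a,b] × {y}` and `G` with complex derivative `g` there,
`∫_a^b F(x+yi) G(x+yi) dx = −G(a+yi) ∫_b^a F(x+yi) dx − ∫_a^b g(x+yi) (∫_b^x F(u+yi) du) dx`.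
[folklore] -/
private theorem integral_mul_weight_horizontal' {F G g : ℂ → ℂ} (y : ℝ) (hab : a ≤ b)
    (hF : ∀ x ∈ Icc a b, ContinuousAt F (x + y * I))
    (hG : ∀ x ∈ Icc a b, HasDerivAt G (g (x + y * I)) (x + y * I))
    (hg : ∀ x ∈ Icc a b, ContinuousAt g (x + y * I)) :
    ∫ x : ℝ in a..b, F (x + y * I) * G (x + y * I) =
      -(G (a + y * I) * ∫ x : ℝ in b..a, F (x + y * I)) -
        ∫ x : ℝ in a..b, g (x + y * I) * (∫ u : ℝ in b..x, F (u + y * I)) := by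
  obtain ⟨hΛc, hΛd⟩ := hasDerivAt_primitive_horizontal y hab ⟨hab, le_rfl⟩ hF
  have hint : IntervalIntegrable (fun u : ℝ ↦ F (u + y * I)) volume a b :=
    intervalIntegrable_of_continuousAt_horizontal y hab hF
  have hgint : IntervalIntegrable (fun u : ℝ ↦ g (u + y * I)) volume a b :=
    intervalIntegrable_of_continuousAt_horizontal y hab hg
  have hu : ∀ x ∈ Ioo (min a b) (max a b),
      HasDerivAt (fun x : ℝ ↦ G (x + y * I)) (g (x + y * I)) x := by
    intro x hx
    rw [min_eq_left hab, max_eq_right hab] at hx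
    have h1 : HasDerivAt (fun w : ℂ ↦ w + y * I) 1 (x : ℂ) := (hasDerivAt_id (x : ℂ)).add_const _
    have h2 := (hG x (Ioo_subset_Icc_self hx)).comp (x : ℂ) h1
    rw [mul_one] at h2
    exact h2.comp_ofReal
  have hGc : ContinuousOn (fun x : ℝ ↦ G (x + y * I)) (uIcc a b) := by
    rw [uIcc_of_le hab]
    intro x hx
    exact ((hG x hx).continuousAt.comp (f := fun x : ℝ ↦ (x : ℂ) + y * I)
      (by fun_prop)).continuousWithinAt
  have hv : ∀ x ∈ Ioo (min a b) (max a b),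
      HasDerivAt (fun x : ℝ ↦ ∫ u : ℝ in b..x, F (u + y * I)) (F (x + y * I)) x := by
    intro x hx
    rw [min_eq_left hab, max_eq_right hab] at hx
    exact hΛd x hx
  have hparts := integral_mul_deriv_eq_deriv_mul_of_hasDerivAt
    (u := fun x : ℝ ↦ G (x + y * I)) (v := fun x : ℝ ↦ ∫ u : ℝ in b..x, F (u + y * I))
    (u' := fun x : ℝ ↦ g (x + y * I)) (v' := fun x : ℝ ↦ F (x + y * I))
    hGc (by rwa [uIcc_of_le hab]) hu hv hgint hint
  rw [intervalIntegral.integral_same, mul_zero, zero_sub] at hparts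
  calc ∫ x : ℝ in a..b, F (x + y * I) * G (x + y * I)
      = ∫ x : ℝ in a..b, G (x + y * I) * F (x + y * I) := by
        congr 1; ext x; ring
    _ = _ := by rw [hparts]

/-- **Integration by parts on a vertical edge**, general weight: for `F`, `g` continuous at every
point of `{x} × [c,d]` and `G` with complex derivative `g` there,
`∫_c^d F(x+yi) G(x+yi) dy = G(x+di) ∫_c^d F(x+yi) dy − i ∫_c^d g(x+yi) (∫_c^y F(x+ui) du) dy`.
[folklore] -/
private theorem integral_mul_weight_vertical' {F G g : ℂ → ℂ} (x : ℝ) (hcd : c ≤ d)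
    (hF : ∀ y ∈ Icc c d, ContinuousAt F (x + y * I))
    (hG : ∀ y ∈ Icc c d, HasDerivAt G (g (x + y * I)) (x + y * I))
    (hg : ∀ y ∈ Icc c d, ContinuousAt g (x + y * I)) :
    ∫ y : ℝ in c..d, F (x + y * I) * G (x + y * I) =
      G (x + d * I) * (∫ y : ℝ in c..d, F (x + y * I)) -
        I * ∫ y : ℝ in c..d, g (x + y * I) * (∫ u : ℝ in c..y, F (x + u * I)) := by
  obtain ⟨hΛc, hΛd⟩ := hasDerivAt_primitive_vertical x hcd ⟨le_rfl, hcd⟩ hF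
  have hint : IntervalIntegrable (fun u : ℝ ↦ F (x + u * I)) volume c d :=
    intervalIntegrable_of_continuousAt_vertical x hcd hF
  have hgint : IntervalIntegrable (fun u : ℝ ↦ g (x + u * I) * I) volume c d :=
    (intervalIntegrable_of_continuousAt_vertical x hcd hg).mul_const I
  have hu : ∀ y ∈ Ioo (min c d) (max c d),
      HasDerivAt (fun y : ℝ ↦ G (x + y * I)) (g (x + y * I) * I) y := by
    intro y hy
    rw [min_eq_left hcd, max_eq_right hcd] at hy
    have h1 : HasDerivAt (fun w : ℂ ↦ (x : ℂ) + w * I) (1 * I) (y : ℂ) :=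
      ((hasDerivAt_id (y : ℂ)).mul_const I).const_add _
    have h2 := (hG y (Ioo_subset_Icc_self hy)).comp (y : ℂ) h1
    rw [one_mul] at h2
    exact h2.comp_ofReal
  have hGc : ContinuousOn (fun y : ℝ ↦ G (x + y * I)) (uIcc c d) := by
    rw [uIcc_of_le hcd]
    intro y hy
    exact ((hG y hy).continuousAt.comp (f := fun y : ℝ ↦ (x : ℂ) + y * I)
      (by fun_prop)).continuousWithinAt
  have hv : ∀ y ∈ Ioo (min c d) (max c d),
      HasDerivAt (fun y : ℝ ↦ ∫ u : ℝ in c..y, F (x + u * I)) (F (x + y * I)) y := by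
    intro y hy
    rw [min_eq_left hcd, max_eq_right hcd] at hy
    exact hΛd y hy
  have hparts := integral_mul_deriv_eq_deriv_mul_of_hasDerivAt
    (u := fun y : ℝ ↦ G (x + y * I)) (v := fun y : ℝ ↦ ∫ u : ℝ in c..y, F (x + u * I))
    (u' := fun y : ℝ ↦ g (x + y * I) * I) (v' := fun y : ℝ ↦ F (x + y * I))
    hGc (by rwa [uIcc_of_le hcd]) hu hv hgint hint
  rw [intervalIntegral.integral_same, mul_zero, sub_zero] at hparts
  have hI : ∫ y : ℝ in c..d, g (x + y * I) * I * (∫ u : ℝ in c..y, F (x + u * I)) =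
      I * ∫ y : ℝ in c..d, g (x + y * I) * (∫ u : ℝ in c..y, F (x + u * I)) := by
    rw [← intervalIntegral.integral_const_mul]
    congr 1; ext y; ring
  calc ∫ y : ℝ in c..d, F (x + y * I) * G (x + y * I)
      = ∫ y : ℝ in c..d, G (x + y * I) * F (x + y * I) := by
        congr 1; ext y; ring
    _ = _ := by rw [hparts, hI]

/-! ### Continuous logarithms along the right edge -/

/-- Along a vertical segment on which `f` is analytic and zero-free, the primitive
`V(y) = ∫_c^y (f'/f)(x + ui) du` satisfies `exp(i V(y)) = f(x + yi)/f(x + ci)`: `i V` is the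
branch of `log (f/f(x+ci))` along the edge. [folklore] -/
private theorem exp_I_mul_primitive_vertical {f : ℂ → ℂ} (x : ℝ) (hcd : c ≤ d)
    (hA : ∀ y ∈ Icc c d, AnalyticAt ℂ f (x + y * I)) (h0 : ∀ y ∈ Icc c d, f (x + y * I) ≠ 0)
    {y : ℝ} (hy : y ∈ Icc c d) :
    Complex.exp (I * ∫ u : ℝ in c..y, deriv f (x + u * I) / f (x + u * I)) =
      f (x + y * I) / f (x + c * I) := by
  have hF : ∀ t ∈ Icc c d, ContinuousAt (fun w ↦ deriv f w / f w) (x + t * I) := fun t ht ↦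
    continuousAt_logDeriv (hA t ht) (h0 t ht)
  obtain ⟨hVc, hVd⟩ := hasDerivAt_primitive_vertical (F := fun w ↦ deriv f w / f w) x hcd
    ⟨le_rfl, hcd⟩ hF
  set V : ℝ → ℂ := fun t ↦ ∫ u : ℝ in c..t, deriv f (x + u * I) / f (x + u * I) with hV
  set φ : ℝ → ℂ := fun t ↦ f (x + t * I) * Complex.exp (-(I * V t)) with hφ
  have hfc : ∀ t ∈ Icc c d, ContinuousAt (fun t : ℝ ↦ f (x + t * I)) t := fun t ht ↦
    (hA t ht).continuousAt.comp (f := fun t : ℝ ↦ (x : ℂ) + t * I) (by fun_prop)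
  have hφderiv : ∀ t ∈ Ioo c y, HasDerivAt φ 0 t := by
    intro t ht
    have ht' : t ∈ Ioo c d := ⟨ht.1, ht.2.trans_le hy.2⟩
    have htI : t ∈ Icc c d := Ioo_subset_Icc_self ht'
    have h1 : HasDerivAt (fun t : ℝ ↦ f (x + t * I)) (deriv f (x + t * I) * I) t := by
      have e : HasDerivAt (fun w : ℂ ↦ (x : ℂ) + w * I) (1 * I) (t : ℂ) :=
        ((hasDerivAt_id (t : ℂ)).mul_const I).const_add _
      have h := ((hA t htI).differentiableAt.hasDerivAt).comp (t : ℂ) e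
      rw [one_mul] at h
      exact h.comp_ofReal
    have h2 : HasDerivAt (fun t : ℝ ↦ Complex.exp (-(I * V t)))
        (Complex.exp (-(I * V t)) * (-(I * (deriv f (x + t * I) / f (x + t * I))))) t :=
      ((hVd t ht').const_mul I).neg.cexp
    have h3 := h1.mul h2
    have hzero : deriv f (x + t * I) * I * Complex.exp (-(I * V t)) +
        f (x + t * I) * (Complex.exp (-(I * V t)) * (-(I * (deriv f (x + t * I) / f (x + t * I))))) =
        0 := by
      field_simp [h0 t htI]
      ring
    rw [hzero] at h3
    exact h3
  have hφcont : ContinuousOn φ (Icc c y) := by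
    intro t ht
    have htI : t ∈ Icc c d := ⟨ht.1, ht.2.trans hy.2⟩
    have hVt : ContinuousWithinAt V (Icc c y) t :=
      (hVc t htI).mono (Icc_subset_Icc_right hy.2)
    exact ((hfc t htI).continuousWithinAt).mul ((hVt.const_mul I).neg.cexp)
  have hFTC := integral_eq_sub_of_hasDerivAt_of_le hy.1 hφcont hφderiv
    (by simp : IntervalIntegrable (fun _ : ℝ ↦ (0 : ℂ)) volume c y)
  rw [intervalIntegral.integral_zero] at hFTC
  have hφy : φ y = φ c := by
    have := hFTC.symm
    rwa [sub_eq_zero] at this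
  have hVc0 : V c = 0 := by simp [hV]
  have hφc : φ c = f (x + c * I) := by
    simp only [hφ, hVc0, mul_zero, neg_zero, Complex.exp_zero, mul_one]
  have key : f (x + y * I) * Complex.exp (-(I * V y)) = f (x + c * I) := by
    rw [← hφc, ← hφy]
  show Complex.exp (I * V y) = f (x + y * I) / f (x + c * I)
  rw [eq_div_iff (h0 c ⟨le_rfl, hcd⟩), ← key]
  calc Complex.exp (I * V y) * (f (x + y * I) * Complex.exp (-(I * V y)))
      = f (x + y * I) * (Complex.exp (I * V y) * Complex.exp (-(I * V y))) := by ring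
    _ = f (x + y * I) := by
        rw [← Complex.exp_add, add_neg_cancel, Complex.exp_zero, mul_one]

/-- Two continuous logarithms of the same function along a segment differ by a constant.
[folklore] -/
private theorem branch_sub_eq {Λ₁ Λ₂ : ℝ → ℂ} (h₁ : ContinuousOn Λ₁ (Icc c d))
    (h₂ : ContinuousOn Λ₂ (Icc c d))
    (h : ∀ t ∈ Icc c d, Complex.exp (Λ₁ t) = Complex.exp (Λ₂ t)) :
    ∀ t ∈ Icc c d, Λ₁ t - Λ₂ t = Λ₁ c - Λ₂ c := by
  intro t ht
  have hct : c ≤ t := ht.1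
  have hcd : c ≤ d := ht.1.trans ht.2
  -- the difference of the two branches, normalised at `c`
  set ψ : ℝ → ℂ := fun s ↦ (Λ₁ s - Λ₂ s) - (Λ₁ c - Λ₂ c) with hψ
  have hψn : ∀ s ∈ Icc c d, ∃ n : ℤ, ψ s = n * (2 * Real.pi * I) := by
    intro s hs
    apply Complex.exp_eq_one_iff.mp
    rw [hψ]
    simp only
    rw [Complex.exp_sub, Complex.exp_sub, Complex.exp_sub, h s hs, h c ⟨le_rfl, hcd⟩,
      div_self (Complex.exp_ne_zero _), div_self (Complex.exp_ne_zero _), div_one]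
  have hnorm : ∀ s ∈ Icc c d, ∃ n : ℤ, ‖ψ s‖ = |(n : ℝ)| * (2 * Real.pi) := by
    intro s hs
    obtain ⟨n, hn⟩ := hψn s hs
    refine ⟨n, ?_⟩
    rw [hn, norm_mul, norm_mul, norm_mul, Complex.norm_intCast, Complex.norm_I, mul_one,
      Complex.norm_real, Complex.norm_two, Real.norm_eq_abs, abs_of_pos Real.pi_pos]
  by_contra hne
  have hψt : ψ t ≠ 0 := by
    rw [hψ]; simp only; rwa [sub_ne_zero]
  -- `‖ψ t‖ ≥ 2π`
  obtain ⟨n, hn⟩ := hnorm t ht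
  have hn0 : n ≠ 0 := by
    rintro rfl
    simp only [Int.cast_zero, abs_zero, zero_mul, norm_eq_zero] at hn
    exact hψt hn
  have hge : 2 * Real.pi ≤ ‖ψ t‖ := by
    rw [hn]
    have : (1 : ℝ) ≤ |(n : ℝ)| := by
      rw [← Int.cast_abs]; exact_mod_cast Int.one_le_abs hn0
    nlinarith [Real.pi_pos]
  -- `‖ψ‖` is continuous on `[c, t]` and vanishes at `c`
  have hψcont : ContinuousOn (fun s ↦ ‖ψ s‖) (Icc c t) := by
    have hsub : Icc c t ⊆ Icc c d := Icc_subset_Icc_right ht.2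
    exact (((h₁.mono hsub).sub (h₂.mono hsub)).sub continuousOn_const).norm
  have hψc : ‖ψ c‖ = 0 := by simp [hψ]
  obtain ⟨s, hs, hsπ⟩ : ∃ s ∈ Icc c t, ‖ψ s‖ = Real.pi := by
    have hIVT := intermediate_value_Icc hct hψcont
    have hmem : Real.pi ∈ Icc (‖ψ c‖) (‖ψ t‖) := by
      rw [hψc]; exact ⟨Real.pi_pos.le, by linarith [Real.pi_pos]⟩
    exact hIVT hmem
  obtain ⟨m, hm⟩ := hnorm s ⟨hs.1, hs.2.trans ht.2⟩
  rw [hsπ] at hm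
  have h2m : (2 : ℝ) * |(m : ℝ)| = 1 := by
    have hπ := Real.pi_pos
    field_simp at hm
    linarith
  rw [← Int.cast_abs] at h2m
  have : (2 : ℤ) * |m| = 1 := by exact_mod_cast h2m
  omega


/-! ### The three explicit kernel integrals -/

/-- `G(b − HI) = −(2H/π) cosh(π(b − a)/(2H)) · I`. [folklore] -/
private theorem primKernel_right_bot {H : ℝ} (hH : H ≠ 0) (a b : ℝ) :
    2 * I * H / Real.pi *
        Complex.sin ((Real.pi : ℂ) * (((b : ℂ) + (-H : ℝ) * I) - a) / (2 * I * H)) =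
      -((2 * H / Real.pi * Real.cosh (Real.pi * (b - a) / (2 * H)) : ℝ) : ℂ) * I := by
  have h : Real.pi * (-H) / (2 * H) = -(Real.pi / 2) := by field_simp
  rw [primKernel_apply hH, h]
  simp only [Real.cos_neg, Real.sin_neg, Real.cos_pi_div_two, Real.sin_pi_div_two, zero_mul,
    mul_zero, ofReal_zero, zero_add, neg_mul, one_mul]
  push_cast
  ring

/-- The right-edge kernel of Lemma 2.1 is Selberg's kernel at `s = W₁ + tI`. [folklore] -/
private theorem rightKernel_eq (W₀ W₁ H t : ℝ) :
    rightKernel W₀ W₁ H t =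
      Complex.cos ((Real.pi : ℂ) * (((W₁ : ℂ) + t * I) - W₀) / (2 * I * H)) := by
  unfold rightKernel
  congr 1
  push_cast
  ring

/-- `∫_{−H}^{H} cos(π(W₁ − W₀ + it)/(2iH)) dt = (4H/π) cosh(π(W₁ − W₀)/(2H))` (a real number).
[folklore] -/
private theorem integral_rightKernel {H : ℝ} (hH : 0 < H) (W₀ W₁ : ℝ) :
    ∫ t in (-H)..H, rightKernel W₀ W₁ H t =
      ((4 * H / Real.pi * Real.cosh (Real.pi * (W₁ - W₀) / (2 * H)) : ℝ) : ℂ) := by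
  have hHne : H ≠ 0 := hH.ne'
  -- `t ↦ G(W₁ + tI)` is a primitive of `t ↦ rightKernel t · I`
  have hderiv : ∀ t : ℝ, HasDerivAt (fun t : ℝ ↦ 2 * I * H / Real.pi *
      Complex.sin ((Real.pi : ℂ) * (((W₁ : ℂ) + t * I) - W₀) / (2 * I * H)))
      (rightKernel W₀ W₁ H t * I) t := by
    intro t
    have h1 : HasDerivAt (fun w : ℂ ↦ (W₁ : ℂ) + w * I) (1 * I) (t : ℂ) :=
      ((hasDerivAt_id (t : ℂ)).mul_const I).const_add _
    have h2 := (hasDerivAt_primKernel hHne W₀ ((W₁ : ℂ) + t * I)).comp (t : ℂ) h1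
    rw [one_mul, ← rightKernel_eq] at h2
    exact h2.comp_ofReal
  have hcont : Continuous (fun t : ℝ ↦ rightKernel W₀ W₁ H t) := by
    unfold rightKernel; fun_prop
  have hint : IntervalIntegrable (fun t : ℝ ↦ rightKernel W₀ W₁ H t * I) volume (-H) H :=
    (hcont.mul continuous_const).intervalIntegrable _ _
  have hFTC := integral_eq_sub_of_hasDerivAt (fun t _ ↦ hderiv t) hint
  rw [intervalIntegral.integral_mul_const, primKernel_right_top hHne,
    primKernel_right_bot hHne] at hFTC
  have hI : (∫ t in (-H)..H, rightKernel W₀ W₁ H t) =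
      (∫ t in (-H)..H, rightKernel W₀ W₁ H t) * I * (-I) := by
    rw [mul_assoc, mul_neg, I_mul_I, neg_neg, mul_one]
  rw [hI, hFTC]
  push_cast
  ring_nf
  rw [I_sq]
  ring

/-- `∫_a^b sinh(π(x − a)/(2H)) dx = (2H/π)(cosh(π(b − a)/(2H)) − 1)`. [folklore] -/
private theorem integral_sinh_kernel {H : ℝ} (hH : H ≠ 0) (a b : ℝ) :
    ∫ x in a..b, Real.sinh (Real.pi * (x - a) / (2 * H)) =
      2 * H / Real.pi * (Real.cosh (Real.pi * (b - a) / (2 * H)) - 1) := by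
  have hderiv : ∀ x : ℝ, HasDerivAt (fun x : ℝ ↦ 2 * H / Real.pi *
      Real.cosh (Real.pi * (x - a) / (2 * H))) (Real.sinh (Real.pi * (x - a) / (2 * H))) x := by
    intro x
    have h1 : HasDerivAt (fun x : ℝ ↦ Real.pi * (x - a) / (2 * H)) (Real.pi * 1 / (2 * H)) x :=
      (((hasDerivAt_id x).sub_const a).const_mul Real.pi).div_const (2 * H)
    have h2 := ((Real.hasDerivAt_cosh _).comp x h1).const_mul (2 * H / Real.pi)
    have key : 2 * H / Real.pi * (Real.sinh (Real.pi * (x - a) / (2 * H)) *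
        (Real.pi * 1 / (2 * H))) = Real.sinh (Real.pi * (x - a) / (2 * H)) := by
      field_simp
    rw [key] at h2
    exact h2
  have hint : IntervalIntegrable (fun x : ℝ ↦ Real.sinh (Real.pi * (x - a) / (2 * H)))
      volume a b := (by fun_prop : Continuous fun x : ℝ ↦
        Real.sinh (Real.pi * (x - a) / (2 * H))).intervalIntegrable _ _
  rw [integral_eq_sub_of_hasDerivAt (fun x _ ↦ hderiv x) hint]
  simp only [sub_self, mul_zero, zero_div, Real.cosh_zero]
  ring

/-- `∫_{−H}^{H} cos(πy/(2H)) dy = 4H/π`. [folklore] -/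
private theorem integral_cos_kernel {H : ℝ} (hH : H ≠ 0) :
    ∫ y in (-H)..H, Real.cos (Real.pi * y / (2 * H)) = 4 * H / Real.pi := by
  have hderiv : ∀ y : ℝ, HasDerivAt (fun y : ℝ ↦ 2 * H / Real.pi *
      Real.sin (Real.pi * y / (2 * H))) (Real.cos (Real.pi * y / (2 * H))) y := by
    intro y
    have h1 : HasDerivAt (fun y : ℝ ↦ Real.pi * y / (2 * H)) (Real.pi * 1 / (2 * H)) y :=
      ((hasDerivAt_id y).const_mul Real.pi).div_const (2 * H)
    have h2 := ((Real.hasDerivAt_sin _).comp y h1).const_mul (2 * H / Real.pi)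
    have key : 2 * H / Real.pi * (Real.cos (Real.pi * y / (2 * H)) * (Real.pi * 1 / (2 * H))) =
        Real.cos (Real.pi * y / (2 * H)) := by
      field_simp
    rw [key] at h2
    exact h2
  have hint : IntervalIntegrable (fun y : ℝ ↦ Real.cos (Real.pi * y / (2 * H))) volume (-H) H :=
    (by fun_prop : Continuous fun y : ℝ ↦ Real.cos (Real.pi * y / (2 * H))).intervalIntegrable _ _
  rw [integral_eq_sub_of_hasDerivAt (fun y _ ↦ hderiv y) hint]
  have h1 : Real.pi * H / (2 * H) = Real.pi / 2 := by field_simp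
  have h2 : Real.pi * (-H) / (2 * H) = -(Real.pi / 2) := by field_simp
  rw [h1, h2, Real.sin_neg, Real.sin_pi_div_two]
  ring


/-! ### Selberg's lemma for a box with zero-free boundary -/

/-- **Selberg's box lemma when `f` does not vanish on the boundary of the box.** For `f` analytic
at every point of the closed box `[W₀, W₁] × [−H, H]` (`H > 0`, `W₀ < W₁`) and non-zero on its
four edges, and any continuous branch `Λ` of `log f(W₁ + it)` on `[−H, H]`, the identity of
Conrey–Soundararajan's Lemma 2.1 holds. (Proof: the weighted argument principle
`integral_boundary_rect_logDeriv_mul` with the weight `G(s) = (2iH/π) sin(π(s − W₀)/(2iH))`,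
`G' =` Selberg's kernel, integrated by parts on the four edges; `G` is purely imaginary on the
left and horizontal edges, so only `log |f|` survives there after taking imaginary parts.)
[cite: ConreySoundararajan2002, §2 Lemma 2.1 (proof)] -/
theorem identity_of_ne_zero_on_boundary {f : ℂ → ℂ} {W₀ W₁ H : ℝ} (hH : 0 < H) (hW : W₀ < W₁)
    (hf : AnalyticOnNhd ℂ f (Icc W₀ W₁ ×ℂ Icc (-H) H))
    (h_left : ∀ t ∈ Icc (-H) H, f ((W₀ : ℂ) + t * I) ≠ 0)
    (h_right : ∀ t ∈ Icc (-H) H, f ((W₁ : ℂ) + t * I) ≠ 0)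
    (h_top : ∀ α ∈ Icc W₀ W₁, f ((α : ℂ) + H * I) ≠ 0)
    (h_bot : ∀ α ∈ Icc W₀ W₁, f ((α : ℂ) + ((-H : ℝ) : ℂ) * I) ≠ 0)
    {Λ : ℝ → ℂ} (hΛ : ContinuousOn Λ (Icc (-H) H))
    (hΛf : ∀ t ∈ Icc (-H) H, Complex.exp (Λ t) = f ((W₁ : ℂ) + t * I)) :
    4 * H * ∑ᶠ ρ ∈ {ρ : ℂ | f ρ = 0 ∧ ρ ∈ Icc W₀ W₁ ×ℂ Icc (-H) H},
        (analyticOrderNatAt f ρ : ℝ) * weight W₀ H ρ =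
      (∫ t in (-H)..H, Real.cos (Real.pi * t / (2 * H)) * Real.log ‖f ((W₀ : ℂ) + t * I)‖) +
        (∫ α in W₀..W₁, Real.sinh (Real.pi * (α - W₀) / (2 * H)) *
          Real.log ‖f ((α : ℂ) + H * I) * f ((α : ℂ) - H * I)‖) -
        (∫ t in (-H)..H, rightKernel W₀ W₁ H t * Λ t).re := by
  have hHne : H ≠ 0 := hH.ne'
  have hcd : -H < H := by linarith
  -- analyticity and non-vanishing of `f` at the edge points
  have hA_bot : ∀ x ∈ Icc W₀ W₁, AnalyticAt ℂ f (x + ((-H : ℝ) : ℂ) * I) := fun x hx ↦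
    hf _ ⟨by simpa using hx, by simpa using hcd.le⟩
  have hA_top : ∀ x ∈ Icc W₀ W₁, AnalyticAt ℂ f (x + H * I) := fun x hx ↦
    hf _ ⟨by simpa using hx, by simpa using hcd.le⟩
  have hA_left : ∀ y ∈ Icc (-H) H, AnalyticAt ℂ f (W₀ + y * I) := fun y hy ↦
    hf _ ⟨by simpa using hW.le, by simpa using hy⟩
  have hA_right : ∀ y ∈ Icc (-H) H, AnalyticAt ℂ f (W₁ + y * I) := fun y hy ↦
    hf _ ⟨by simpa using hW.le, by simpa using hy⟩
  set F : ℂ → ℂ := fun z ↦ deriv f z / f z with hFdef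
  have hF_bot : ∀ x ∈ Icc W₀ W₁, ContinuousAt F (x + ((-H : ℝ) : ℂ) * I) := fun x hx ↦
    continuousAt_logDeriv (hA_bot x hx) (h_bot x hx)
  have hF_top : ∀ x ∈ Icc W₀ W₁, ContinuousAt F (x + H * I) := fun x hx ↦
    continuousAt_logDeriv (hA_top x hx) (h_top x hx)
  have hF_left : ∀ y ∈ Icc (-H) H, ContinuousAt F (W₀ + y * I) := fun y hy ↦
    continuousAt_logDeriv (hA_left y hy) (h_left y hy)
  have hF_right : ∀ y ∈ Icc (-H) H, ContinuousAt F (W₁ + y * I) := fun y hy ↦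
    continuousAt_logDeriv (hA_right y hy) (h_right y hy)
  -- Selberg's kernel `g` and its primitive `G`
  set g : ℂ → ℂ := fun s ↦ Complex.cos ((Real.pi : ℂ) * (s - W₀) / (2 * I * H)) with hgdef
  set G : ℂ → ℂ := fun s ↦ 2 * I * H / Real.pi *
    Complex.sin ((Real.pi : ℂ) * (s - W₀) / (2 * I * H)) with hGdef
  have hGd : ∀ z, HasDerivAt G (g z) z := fun z ↦ hasDerivAt_primKernel hHne W₀ z
  have hGdiff : Differentiable ℂ G := fun z ↦ (hGd z).differentiableAt
  have hG_an : AnalyticOnNhd ℂ G (Icc W₀ W₁ ×ℂ Icc (-H) H) := fun z _ ↦ hGdiff.analyticAt z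
  have hg_cont : ∀ z, ContinuousAt g z := by
    intro z
    simp only [hgdef]
    exact Complex.continuous_cos.continuousAt.comp (by fun_prop)
  -- Step 1: the weighted argument principle with the weight `G`
  have hWAP := integral_boundary_rect_logDeriv_mul hW hcd hf hG_an h_bot h_top h_left h_right
  -- Step 2: integration by parts on the four edges
  have hBot := integral_mul_weight_horizontal' (F := F) (G := G) (g := g) (-H) hW.le hF_bot
    (fun x _ ↦ hGd _) (fun x _ ↦ hg_cont _)
  have hTop := integral_mul_weight_horizontal' (F := F) (G := G) (g := g) H hW.le hF_top
    (fun x _ ↦ hGd _) (fun x _ ↦ hg_cont _)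
  have hRight := integral_mul_weight_vertical' (F := F) (G := G) (g := g) W₁ hcd.le hF_right
    (fun y _ ↦ hGd _) (fun y _ ↦ hg_cont _)
  have hLeft := integral_mul_weight_vertical' (F := F) (G := G) (g := g) W₀ hcd.le hF_left
    (fun y _ ↦ hGd _) (fun y _ ↦ hg_cont _)
  simp only [hFdef] at hBot hTop hRight hLeft
  rw [hBot, hTop, hRight, hLeft] at hWAP
  -- continuity of the edge primitives and of `log ‖f‖` along the edges
  have hΛb_cont := (hasDerivAt_primitive_horizontal (F := F) (-H) hW.le ⟨hW.le, le_rfl⟩ hF_bot).1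
  have hΛt_cont := (hasDerivAt_primitive_horizontal (F := F) H hW.le ⟨hW.le, le_rfl⟩ hF_top).1
  have hVr_cont := (hasDerivAt_primitive_vertical (F := F) W₁ hcd.le ⟨le_rfl, hcd.le⟩ hF_right).1
  have hVl_cont := (hasDerivAt_primitive_vertical (F := F) W₀ hcd.le ⟨le_rfl, hcd.le⟩ hF_left).1
  simp only [hFdef] at hΛb_cont hΛt_cont hVr_cont hVl_cont
  have hLb_cont : ContinuousOn (fun x : ℝ ↦ Real.log ‖f (x + ((-H : ℝ) : ℂ) * I)‖) (Icc W₀ W₁) :=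
    fun x hx ↦ ((((hA_bot x hx).continuousAt.comp (f := fun t : ℝ ↦ (t : ℂ) + ((-H : ℝ) : ℂ) * I)
      (by fun_prop)).norm).log (norm_ne_zero_iff.2 (h_bot x hx))).continuousWithinAt
  have hLt_cont : ContinuousOn (fun x : ℝ ↦ Real.log ‖f (x + H * I)‖) (Icc W₀ W₁) :=
    fun x hx ↦ ((((hA_top x hx).continuousAt.comp (f := fun t : ℝ ↦ (t : ℂ) + H * I)
      (by fun_prop)).norm).log (norm_ne_zero_iff.2 (h_top x hx))).continuousWithinAt
  have hLl_cont : ContinuousOn (fun y : ℝ ↦ Real.log ‖f (W₀ + y * I)‖) (Icc (-H) H) :=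
    fun y hy ↦ ((((hA_left y hy).continuousAt.comp (f := fun t : ℝ ↦ (W₀ : ℂ) + t * I)
      (by fun_prop)).norm).log (norm_ne_zero_iff.2 (h_left y hy))).continuousWithinAt
  -- `Re` of the horizontal primitives and `Im` of the vertical ones are `log ‖f‖`
  have hre_bot : ∀ x ∈ Icc W₀ W₁,
      (∫ u in W₁..x, deriv f (u + ((-H : ℝ) : ℂ) * I) / f (u + ((-H : ℝ) : ℂ) * I)).re =
        Real.log ‖f (x + ((-H : ℝ) : ℂ) * I)‖ - Real.log ‖f (W₁ + ((-H : ℝ) : ℂ) * I)‖ := by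
    intro x hx
    rw [intervalIntegral.integral_symm, neg_re,
      re_integral_logDeriv_horizontal (-H) hx.2 (fun u hu ↦ hA_bot u ⟨hx.1.trans hu.1, hu.2⟩)
        (fun u hu ↦ h_bot u ⟨hx.1.trans hu.1, hu.2⟩)]
    ring
  have hre_top : ∀ x ∈ Icc W₀ W₁,
      (∫ u in W₁..x, deriv f (u + H * I) / f (u + H * I)).re =
        Real.log ‖f (x + H * I)‖ - Real.log ‖f (W₁ + H * I)‖ := by
    intro x hx
    rw [intervalIntegral.integral_symm, neg_re,
      re_integral_logDeriv_horizontal H hx.2 (fun u hu ↦ hA_top u ⟨hx.1.trans hu.1, hu.2⟩)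
        (fun u hu ↦ h_top u ⟨hx.1.trans hu.1, hu.2⟩)]
    ring
  have him_right : ∀ y ∈ Icc (-H) H,
      (∫ u in (-H)..y, deriv f (W₁ + u * I) / f (W₁ + u * I)).im =
        -(Real.log ‖f (W₁ + y * I)‖ - Real.log ‖f (W₁ + ((-H : ℝ) : ℂ) * I)‖) := fun y hy ↦
    im_integral_logDeriv_vertical W₁ hy.1 (fun u hu ↦ hA_right u ⟨hu.1, hu.2.trans hy.2⟩)
      (fun u hu ↦ h_right u ⟨hu.1, hu.2.trans hy.2⟩)
  have him_left : ∀ y ∈ Icc (-H) H,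
      (∫ u in (-H)..y, deriv f (W₀ + u * I) / f (W₀ + u * I)).im =
        -(Real.log ‖f (W₀ + y * I)‖ - Real.log ‖f (W₀ + ((-H : ℝ) : ℂ) * I)‖) := fun y hy ↦
    im_integral_logDeriv_vertical W₀ hy.1 (fun u hu ↦ hA_left u ⟨hu.1, hu.2.trans hy.2⟩)
      (fun u hu ↦ h_left u ⟨hu.1, hu.2.trans hy.2⟩)
  -- the values of `G` at the corners
  have hG1 : G (W₀ + ((-H : ℝ) : ℂ) * I) = -(((2 * H / Real.pi : ℝ) : ℂ) * I) := by
    rw [hGdef]; exact primKernel_left_bot hHne W₀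
  have hG2 : G (W₀ + H * I) = ((2 * H / Real.pi : ℝ) : ℂ) * I := by
    rw [hGdef]; exact primKernel_left_top hHne W₀
  have hG3 : G (W₁ + H * I) =
      ((2 * H / Real.pi * Real.cosh (Real.pi * (W₁ - W₀) / (2 * H)) : ℝ) : ℂ) * I := by
    rw [hGdef]; exact primKernel_right_top hHne W₀ W₁
  -- Step 3: real and imaginary parts of the eight edge terms
  have E1 : (G (W₀ + ((-H : ℝ) : ℂ) * I) *
      ∫ x in W₁..W₀, deriv f (x + ((-H : ℝ) : ℂ) * I) / f (x + ((-H : ℝ) : ℂ) * I)).im =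
      -(2 * H / Real.pi) *
        (Real.log ‖f (W₀ + ((-H : ℝ) : ℂ) * I)‖ - Real.log ‖f (W₁ + ((-H : ℝ) : ℂ) * I)‖) := by
    rw [hG1, ← hre_bot W₀ ⟨le_rfl, hW.le⟩]
    simp only [neg_mul, neg_im, mul_im, mul_re, ofReal_re, ofReal_im, I_re, I_im, mul_zero,
      mul_one, zero_mul, add_zero, zero_add, sub_self]
  have E3 : (G (W₀ + H * I) * ∫ x in W₁..W₀, deriv f (x + H * I) / f (x + H * I)).im =
      2 * H / Real.pi * (Real.log ‖f (W₀ + H * I)‖ - Real.log ‖f (W₁ + H * I)‖) := by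
    rw [hG2, ← hre_top W₀ ⟨le_rfl, hW.le⟩]
    simp only [mul_im, mul_re, ofReal_re, ofReal_im, I_re, I_im, mul_zero, mul_one, zero_mul,
      add_zero, zero_add, sub_self]
  have E5 : (G (W₁ + H * I) * ∫ y in (-H)..H, deriv f (W₁ + y * I) / f (W₁ + y * I)).re =
      2 * H / Real.pi * Real.cosh (Real.pi * (W₁ - W₀) / (2 * H)) *
        (Real.log ‖f (W₁ + H * I)‖ - Real.log ‖f (W₁ + ((-H : ℝ) : ℂ) * I)‖) := by
    rw [hG3]
    simp only [mul_re, mul_im, ofReal_re, ofReal_im, I_re, I_im, mul_zero, mul_one, zero_mul,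
      add_zero, sub_self, zero_sub, him_right H ⟨hcd.le, le_rfl⟩]
    ring
  have E7 : (G (W₀ + H * I) * ∫ y in (-H)..H, deriv f (W₀ + y * I) / f (W₀ + y * I)).re =
      2 * H / Real.pi * (Real.log ‖f (W₀ + H * I)‖ - Real.log ‖f (W₀ + ((-H : ℝ) : ℂ) * I)‖) := by
    rw [hG2]
    simp only [mul_re, mul_im, ofReal_re, ofReal_im, I_re, I_im, mul_zero, mul_one, zero_mul,
      add_zero, sub_self, zero_sub, him_left H ⟨hcd.le, le_rfl⟩]
    ring
  have E2 : (∫ x in W₀..W₁, g (x + ((-H : ℝ) : ℂ) * I) *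
      ∫ u in W₁..x, deriv f (u + ((-H : ℝ) : ℂ) * I) / f (u + ((-H : ℝ) : ℂ) * I)).im =
      -∫ x in W₀..W₁, Real.sinh (Real.pi * (x - W₀) / (2 * H)) *
        (Real.log ‖f (x + ((-H : ℝ) : ℂ) * I)‖ - Real.log ‖f (W₁ + ((-H : ℝ) : ℂ) * I)‖) := by
    have hcongr : EqOn (fun x : ℝ ↦ g (x + ((-H : ℝ) : ℂ) * I) *
          ∫ u in W₁..x, deriv f (u + ((-H : ℝ) : ℂ) * I) / f (u + ((-H : ℝ) : ℂ) * I))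
        (fun x : ℝ ↦ -(((Real.sinh (Real.pi * (x - W₀) / (2 * H)) : ℝ) : ℂ) * I) *
          ∫ u in W₁..x, deriv f (u + ((-H : ℝ) : ℂ) * I) / f (u + ((-H : ℝ) : ℂ) * I))
        (uIcc W₀ W₁) := by
      intro x _
      have hgx : g (x + ((-H : ℝ) : ℂ) * I) =
          -((Real.sinh (Real.pi * (x - W₀) / (2 * H)) : ℝ) : ℂ) * I := by
        rw [hgdef]; exact kernel_bot hHne W₀ x
      simp only [hgx, neg_mul]
    rw [intervalIntegral.integral_congr hcongr]
    have hint : IntervalIntegrable (fun x : ℝ ↦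
        -(((Real.sinh (Real.pi * (x - W₀) / (2 * H)) : ℝ) : ℂ) * I) *
          ∫ u in W₁..x, deriv f (u + ((-H : ℝ) : ℂ) * I) / f (u + ((-H : ℝ) : ℂ) * I))
        volume W₀ W₁ := by
      apply ContinuousOn.intervalIntegrable
      rw [uIcc_of_le hW.le]
      exact ((by fun_prop : Continuous fun x : ℝ ↦
        -(((Real.sinh (Real.pi * (x - W₀) / (2 * H)) : ℝ) : ℂ) * I)).continuousOn).mul hΛb_cont
    have him := intervalIntegral_im hint
    simp only [RCLike.im_to_complex] at him
    rw [← him, ← intervalIntegral.integral_neg]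
    apply intervalIntegral.integral_congr
    intro x hx
    rw [uIcc_of_le hW.le] at hx
    simp only [neg_mul, neg_im, mul_im, mul_re, ofReal_re, ofReal_im, I_re, I_im, mul_zero,
      mul_one, zero_mul, add_zero, zero_add, sub_self, hre_bot x hx]
  have E4 : (∫ x in W₀..W₁, g (x + H * I) *
      ∫ u in W₁..x, deriv f (u + H * I) / f (u + H * I)).im =
      ∫ x in W₀..W₁, Real.sinh (Real.pi * (x - W₀) / (2 * H)) *
        (Real.log ‖f (x + H * I)‖ - Real.log ‖f (W₁ + H * I)‖) := by
    have hcongr : EqOn (fun x : ℝ ↦ g (x + H * I) *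
          ∫ u in W₁..x, deriv f (u + H * I) / f (u + H * I))
        (fun x : ℝ ↦ (((Real.sinh (Real.pi * (x - W₀) / (2 * H)) : ℝ) : ℂ) * I) *
          ∫ u in W₁..x, deriv f (u + H * I) / f (u + H * I)) (uIcc W₀ W₁) := by
      intro x _
      have hgx : g (x + H * I) = ((Real.sinh (Real.pi * (x - W₀) / (2 * H)) : ℝ) : ℂ) * I := by
        rw [hgdef]; exact kernel_top hHne W₀ x
      simp only [hgx]
    rw [intervalIntegral.integral_congr hcongr]
    have hint : IntervalIntegrable (fun x : ℝ ↦
        (((Real.sinh (Real.pi * (x - W₀) / (2 * H)) : ℝ) : ℂ) * I) *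
          ∫ u in W₁..x, deriv f (u + H * I) / f (u + H * I)) volume W₀ W₁ := by
      apply ContinuousOn.intervalIntegrable
      rw [uIcc_of_le hW.le]
      exact ((by fun_prop : Continuous fun x : ℝ ↦
        (((Real.sinh (Real.pi * (x - W₀) / (2 * H)) : ℝ) : ℂ) * I)).continuousOn).mul hΛt_cont
    have him := intervalIntegral_im hint
    simp only [RCLike.im_to_complex] at him
    rw [← him]
    apply intervalIntegral.integral_congr
    intro x hx
    rw [uIcc_of_le hW.le] at hx
    simp only [mul_im, mul_re, ofReal_re, ofReal_im, I_re, I_im, mul_zero, mul_one, zero_mul,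
      add_zero, zero_add, sub_self, hre_top x hx]
  have E8 : (∫ y in (-H)..H, g (W₀ + y * I) *
      ∫ u in (-H)..y, deriv f (W₀ + u * I) / f (W₀ + u * I)).im =
      -∫ y in (-H)..H, Real.cos (Real.pi * y / (2 * H)) *
        (Real.log ‖f (W₀ + y * I)‖ - Real.log ‖f (W₀ + ((-H : ℝ) : ℂ) * I)‖) := by
    have hcongr : EqOn (fun y : ℝ ↦ g (W₀ + y * I) *
          ∫ u in (-H)..y, deriv f (W₀ + u * I) / f (W₀ + u * I))
        (fun y : ℝ ↦ ((Real.cos (Real.pi * y / (2 * H)) : ℝ) : ℂ) *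
          ∫ u in (-H)..y, deriv f (W₀ + u * I) / f (W₀ + u * I)) (uIcc (-H) H) := by
      intro y _
      have hgy : g (W₀ + y * I) = ((Real.cos (Real.pi * y / (2 * H)) : ℝ) : ℂ) := by
        rw [hgdef]; exact kernel_left hHne W₀ y
      simp only [hgy]
    rw [intervalIntegral.integral_congr hcongr]
    have hint : IntervalIntegrable (fun y : ℝ ↦ ((Real.cos (Real.pi * y / (2 * H)) : ℝ) : ℂ) *
        ∫ u in (-H)..y, deriv f (W₀ + u * I) / f (W₀ + u * I)) volume (-H) H := by
      apply ContinuousOn.intervalIntegrable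
      rw [uIcc_of_le hcd.le]
      exact ((by fun_prop : Continuous fun y : ℝ ↦
        ((Real.cos (Real.pi * y / (2 * H)) : ℝ) : ℂ)).continuousOn).mul hVl_cont
    have him := intervalIntegral_im hint
    simp only [RCLike.im_to_complex] at him
    rw [← him, ← intervalIntegral.integral_neg]
    apply intervalIntegral.integral_congr
    intro y hy
    rw [uIcc_of_le hcd.le] at hy
    simp only [mul_im, ofReal_re, ofReal_im, zero_mul, add_zero, him_left y hy]
    ring
  -- Step 4: the zero sum
  have hcorner : ((W₀ : ℂ) + ((-H : ℝ) : ℂ) * I) ∈ Icc W₀ W₁ ×ℂ Icc (-H) H :=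
    ⟨by simpa using hW.le, by simpa using hcd.le⟩
  have hw0 : f (W₀ + ((-H : ℝ) : ℂ) * I) ≠ 0 := h_bot W₀ ⟨le_rfl, hW.le⟩
  have hfinO := finite_zeros_reProdIm hW.le hcd.le hf hcorner hw0
  have hZ : {ρ : ℂ | f ρ = 0 ∧ ρ ∈ Icc W₀ W₁ ×ℂ Icc (-H) H} =
      {ρ : ℂ | f ρ = 0 ∧ ρ ∈ Ioo W₀ W₁ ×ℂ Ioo (-H) H} := by
    ext ρ
    constructor
    · rintro ⟨h0, ⟨hza, hzb⟩, ⟨hzc, hzd⟩⟩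
      refine ⟨h0, ?_⟩
      have hz_eq : ρ = (ρ.re : ℂ) + (ρ.im : ℂ) * I := (re_add_im ρ).symm
      rcases hza.eq_or_lt with h | hza'
      · exact absurd h0 (by rw [hz_eq, ← h]; exact h_left ρ.im ⟨hzc, hzd⟩)
      rcases hzb.eq_or_lt with h | hzb'
      · exact absurd h0 (by rw [hz_eq, h]; exact h_right ρ.im ⟨hzc, hzd⟩)
      rcases hzc.eq_or_lt with h | hzc'
      · exact absurd h0 (by rw [hz_eq, ← h]; exact h_bot ρ.re ⟨hza, hzb⟩)
      rcases hzd.eq_or_lt with h | hzd'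
      · exact absurd h0 (by rw [hz_eq, h]; exact h_top ρ.re ⟨hza, hzb⟩)
      exact ⟨⟨hza', hzb'⟩, ⟨hzc', hzd'⟩⟩
    · rintro ⟨h0, h1, h2⟩
      exact ⟨h0, Ioo_subset_Icc_self h1, Ioo_subset_Icc_self h2⟩
  have E9 : (2 * (Real.pi : ℂ) * I * ∑ᶠ ρ ∈ {ρ : ℂ | f ρ = 0 ∧ ρ ∈ Ioo W₀ W₁ ×ℂ Ioo (-H) H},
      ((meromorphicOrderAt f ρ).untop₀ : ℂ) * G ρ).im =
      4 * H * ∑ᶠ ρ ∈ {ρ : ℂ | f ρ = 0 ∧ ρ ∈ Icc W₀ W₁ ×ℂ Icc (-H) H},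
        (analyticOrderNatAt f ρ : ℝ) * weight W₀ H ρ := by
    rw [hZ, finsum_mem_eq_finite_toFinset_sum _ hfinO, finsum_mem_eq_finite_toFinset_sum _ hfinO]
    have h2pi : ∀ z : ℂ, (2 * (Real.pi : ℂ) * I * z).im = 2 * Real.pi * z.re := by
      intro z
      simp only [mul_im, mul_re, I_re, I_im, ofReal_re, ofReal_im, re_ofNat, im_ofNat, mul_zero,
        mul_one, zero_mul, sub_zero, add_zero, zero_add, sub_self]
    rw [h2pi, Complex.re_sum, Finset.mul_sum, Finset.mul_sum]
    refine Finset.sum_congr rfl fun ρ hρ ↦ ?_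
    have hρ' := (Set.Finite.mem_toFinset hfinO).mp hρ
    have hρK : ρ ∈ Icc W₀ W₁ ×ℂ Icc (-H) H :=
      ⟨Ioo_subset_Icc_self hρ'.2.1, Ioo_subset_Icc_self hρ'.2.2⟩
    have hne_top : analyticOrderAt f ρ ≠ ⊤ :=
      analyticOrderAt_ne_top_of_reProdIm hW.le hcd.le hf hcorner hw0 hρK
    have horder : ((meromorphicOrderAt f ρ).untop₀ : ℂ) = (analyticOrderNatAt f ρ : ℂ) := by
      rw [(hf ρ hρK).meromorphicOrderAt_eq, ← Nat.cast_analyticOrderNatAt hne_top]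
      simp
    have hGre : (G ρ).re = 2 * H / Real.pi * weight W₀ H ρ := by
      rw [hGdef]; exact primKernel_re hHne W₀ ρ
    rw [horder, mul_re, natCast_re, natCast_im, zero_mul, sub_zero, hGre]
    field_simp
    ring
  -- Step 5: take imaginary parts
  have hIm := congrArg Complex.im hWAP
  simp only [sub_im, add_im, neg_im, sub_re, I_mul_im, I_mul_re, E1, E2, E3, E4, E5, E7, E8,
    E9] at hIm
  -- Step 6: the branch `Λ` along the right edge
  have hmem : (-H) ∈ Icc (-H) H := ⟨le_rfl, hcd.le⟩
  have hbranch : ∀ t ∈ Icc (-H) H,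
      Λ t = Λ (-H) + I * ∫ u in (-H)..t, deriv f (W₁ + u * I) / f (W₁ + u * I) := by
    have hΛ₀c : ContinuousOn
        (fun t ↦ Λ (-H) + I * ∫ u in (-H)..t, deriv f (W₁ + u * I) / f (W₁ + u * I))
        (Icc (-H) H) := continuousOn_const.add (continuousOn_const.mul hVr_cont)
    have hexp : ∀ t ∈ Icc (-H) H, Complex.exp (Λ t) =
        Complex.exp (Λ (-H) + I * ∫ u in (-H)..t, deriv f (W₁ + u * I) / f (W₁ + u * I)) := by
      intro t ht
      rw [Complex.exp_add, exp_I_mul_primitive_vertical W₁ hcd.le hA_right h_right ht, hΛf t ht,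
        hΛf (-H) hmem, mul_div_assoc', mul_div_cancel_left₀ _ (h_right (-H) hmem)]
    intro t ht
    have key := branch_sub_eq hΛ hΛ₀c hexp t ht
    simp only [intervalIntegral.integral_same, mul_zero, add_zero, sub_self] at key
    linear_combination key
  have hΛre : (Λ (-H)).re = Real.log ‖f (W₁ + ((-H : ℝ) : ℂ) * I)‖ := by
    rw [← hΛf (-H) hmem, Complex.norm_exp, Real.log_exp]
  have hRK : (∫ t in (-H)..H, rightKernel W₀ W₁ H t * Λ t).re =
      4 * H / Real.pi * Real.cosh (Real.pi * (W₁ - W₀) / (2 * H)) *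
          Real.log ‖f (W₁ + ((-H : ℝ) : ℂ) * I)‖ -
        (∫ y in (-H)..H, g (W₁ + y * I) *
          ∫ u in (-H)..y, deriv f (W₁ + u * I) / f (W₁ + u * I)).im := by
    have hcongr : EqOn (fun t ↦ rightKernel W₀ W₁ H t * Λ t)
        (fun t ↦ Λ (-H) * rightKernel W₀ W₁ H t +
          I * (g (W₁ + t * I) * ∫ u in (-H)..t, deriv f (W₁ + u * I) / f (W₁ + u * I)))
        (uIcc (-H) H) := by
      intro t ht
      rw [uIcc_of_le hcd.le] at ht
      have hgt : g (W₁ + t * I) = rightKernel W₀ W₁ H t := by rw [hgdef, rightKernel_eq]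
      simp only [hbranch t ht, hgt]
      ring
    have hrk_cont : Continuous fun t : ℝ ↦ rightKernel W₀ W₁ H t := by
      unfold rightKernel; fun_prop
    have hint1 : IntervalIntegrable (fun t ↦ Λ (-H) * rightKernel W₀ W₁ H t) volume (-H) H :=
      (continuous_const.mul hrk_cont).intervalIntegrable _ _
    have hint2 : IntervalIntegrable (fun t : ℝ ↦ I * (g (W₁ + t * I) *
        ∫ u in (-H)..t, deriv f (W₁ + u * I) / f (W₁ + u * I))) volume (-H) H := by
      apply ContinuousOn.intervalIntegrable
      rw [uIcc_of_le hcd.le]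
      refine continuousOn_const.mul (ContinuousOn.mul ?_ hVr_cont)
      intro t _
      exact ((hg_cont _).comp (f := fun t : ℝ ↦ (W₁ : ℂ) + t * I)
        (by fun_prop)).continuousWithinAt
    rw [intervalIntegral.integral_congr hcongr, intervalIntegral.integral_add hint1 hint2,
      intervalIntegral.integral_const_mul, intervalIntegral.integral_const_mul,
      integral_rightKernel hH, add_re, I_mul_re, mul_re, ofReal_re, ofReal_im, mul_zero,
      sub_zero, hΛre]
    ring
  -- Step 7: `log ‖f(α + Hi) f(α − Hi)‖ = log ‖f(α + Hi)‖ + log ‖f(α − Hi)‖`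
  have hbot_pt : ∀ α : ℝ, (α : ℂ) - H * I = α + ((-H : ℝ) : ℂ) * I := by
    intro α; push_cast; ring
  have hsq_cont : Continuous fun α : ℝ ↦ Real.sinh (Real.pi * (α - W₀) / (2 * H)) := by
    fun_prop
  have hcp_cont : Continuous fun y : ℝ ↦ Real.cos (Real.pi * y / (2 * H)) := by fun_prop
  have hprod : (∫ α in W₀..W₁, Real.sinh (Real.pi * (α - W₀) / (2 * H)) *
      Real.log ‖f (α + H * I) * f (α - H * I)‖) =
      (∫ α in W₀..W₁, Real.sinh (Real.pi * (α - W₀) / (2 * H)) * Real.log ‖f (α + H * I)‖) +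
        ∫ α in W₀..W₁, Real.sinh (Real.pi * (α - W₀) / (2 * H)) *
          Real.log ‖f (α + ((-H : ℝ) : ℂ) * I)‖ := by
    have hcongr : EqOn (fun α : ℝ ↦ Real.sinh (Real.pi * (α - W₀) / (2 * H)) *
          Real.log ‖f (α + H * I) * f (α - H * I)‖)
        (fun α : ℝ ↦ Real.sinh (Real.pi * (α - W₀) / (2 * H)) * Real.log ‖f (α + H * I)‖ +
          Real.sinh (Real.pi * (α - W₀) / (2 * H)) * Real.log ‖f (α + ((-H : ℝ) : ℂ) * I)‖)
        (uIcc W₀ W₁) := by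
      intro α hα
      rw [uIcc_of_le hW.le] at hα
      simp only
      rw [hbot_pt α, norm_mul, Real.log_mul (norm_ne_zero_iff.2 (h_top α hα))
        (norm_ne_zero_iff.2 (h_bot α hα))]
      ring
    rw [intervalIntegral.integral_congr hcongr, intervalIntegral.integral_add]
    · exact (hsq_cont.continuousOn.mul hLt_cont).intervalIntegrable_of_Icc hW.le
    · exact (hsq_cont.continuousOn.mul hLb_cont).intervalIntegrable_of_Icc hW.le
  -- Step 8: split off the constant parts of the three real edge integrals
  have hsplit_b : (∫ x in W₀..W₁, Real.sinh (Real.pi * (x - W₀) / (2 * H)) *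
      (Real.log ‖f (x + ((-H : ℝ) : ℂ) * I)‖ - Real.log ‖f (W₁ + ((-H : ℝ) : ℂ) * I)‖)) =
      (∫ x in W₀..W₁, Real.sinh (Real.pi * (x - W₀) / (2 * H)) *
          Real.log ‖f (x + ((-H : ℝ) : ℂ) * I)‖) -
        Real.log ‖f (W₁ + ((-H : ℝ) : ℂ) * I)‖ *
          (2 * H / Real.pi * (Real.cosh (Real.pi * (W₁ - W₀) / (2 * H)) - 1)) := by
    rw [← integral_sinh_kernel hHne W₀ W₁, ← intervalIntegral.integral_const_mul,
      ← intervalIntegral.integral_sub]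
    · apply intervalIntegral.integral_congr
      intro x _
      simp only
      ring
    · exact (hsq_cont.continuousOn.mul hLb_cont).intervalIntegrable_of_Icc hW.le
    · exact (continuous_const.mul hsq_cont).intervalIntegrable _ _
  have hsplit_t : (∫ x in W₀..W₁, Real.sinh (Real.pi * (x - W₀) / (2 * H)) *
      (Real.log ‖f (x + H * I)‖ - Real.log ‖f (W₁ + H * I)‖)) =
      (∫ x in W₀..W₁, Real.sinh (Real.pi * (x - W₀) / (2 * H)) * Real.log ‖f (x + H * I)‖) -
        Real.log ‖f (W₁ + H * I)‖ *
          (2 * H / Real.pi * (Real.cosh (Real.pi * (W₁ - W₀) / (2 * H)) - 1)) := by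
    rw [← integral_sinh_kernel hHne W₀ W₁, ← intervalIntegral.integral_const_mul,
      ← intervalIntegral.integral_sub]
    · apply intervalIntegral.integral_congr
      intro x _
      simp only
      ring
    · exact (hsq_cont.continuousOn.mul hLt_cont).intervalIntegrable_of_Icc hW.le
    · exact (continuous_const.mul hsq_cont).intervalIntegrable _ _
  have hsplit_l : (∫ y in (-H)..H, Real.cos (Real.pi * y / (2 * H)) *
      (Real.log ‖f (W₀ + y * I)‖ - Real.log ‖f (W₀ + ((-H : ℝ) : ℂ) * I)‖)) =
      (∫ y in (-H)..H, Real.cos (Real.pi * y / (2 * H)) * Real.log ‖f (W₀ + y * I)‖) -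
        Real.log ‖f (W₀ + ((-H : ℝ) : ℂ) * I)‖ * (4 * H / Real.pi) := by
    rw [← integral_cos_kernel hHne, ← intervalIntegral.integral_const_mul,
      ← intervalIntegral.integral_sub]
    · apply intervalIntegral.integral_congr
      intro y _
      simp only
      ring
    · exact (hcp_cont.continuousOn.mul hLl_cont).intervalIntegrable_of_Icc hcd.le
    · exact (continuous_const.mul hcp_cont).intervalIntegrable _ _
  -- Step 9: assemble
  rw [hsplit_b, hsplit_t, hsplit_l] at hIm
  rw [hprod, hRK]
  linear_combination (-1 : ℝ) * hIm

end SelbergBox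

/-! ## Stage 2 (appended 2026-08-27, cell `landau-siegel` §C, typer-3 g3): boundary zeros and the
discharge of `selbergBoxLemma` -/

namespace SelbergBox

variable {a b : ℝ}

/-! ### Integrability of `log ‖z(t) − ρ‖` along horizontal and vertical lines -/

/-- `t ↦ log ‖x + ti − ρ‖` is integrable on every bounded interval (at worst a `log |t − Im ρ|`
singularity). [folklore] -/
private theorem intervalIntegrable_log_norm_vertical_sub (x : ℝ) (ρ : ℂ) (a b : ℝ) :
    IntervalIntegrable (fun t : ℝ ↦ Real.log ‖(x : ℂ) + t * I - ρ‖) volume a b := by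
  by_cases hx : x = ρ.re
  · have h : ∀ t : ℝ, ‖(x : ℂ) + t * I - ρ‖ = |t - ρ.im| := by
      intro t
      have : (x : ℂ) + t * I - ρ = ((t - ρ.im : ℝ) : ℂ) * I := by
        apply Complex.ext <;> simp [hx]
      rw [this, norm_mul, Complex.norm_I, mul_one, Complex.norm_real, Real.norm_eq_abs]
    simp_rw [h, Real.log_abs]
    simpa using (intervalIntegrable_log' (a := a - ρ.im) (b := b - ρ.im)).comp_sub_right ρ.im
  · apply Continuous.intervalIntegrable
    apply Continuous.log (by fun_prop)
    intro t h0
    rw [norm_eq_zero] at h0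
    apply hx
    have := congrArg Complex.re h0
    simp at this
    linarith

/-- `s ↦ log ‖s + yi − ρ‖` is integrable on every bounded interval. [folklore] -/
private theorem intervalIntegrable_log_norm_horizontal_sub (y : ℝ) (ρ : ℂ) (a b : ℝ) :
    IntervalIntegrable (fun s : ℝ ↦ Real.log ‖(s : ℂ) + y * I - ρ‖) volume a b := by
  by_cases hy : y = ρ.im
  · have h : ∀ s : ℝ, ‖(s : ℂ) + y * I - ρ‖ = |s - ρ.re| := by
      intro s
      have : (s : ℂ) + y * I - ρ = ((s - ρ.re : ℝ) : ℂ) := by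
        apply Complex.ext <;> simp [hy]
      rw [this, Complex.norm_real, Real.norm_eq_abs]
    simp_rw [h, Real.log_abs]
    simpa using (intervalIntegrable_log' (a := a - ρ.re) (b := b - ρ.re)).comp_sub_right ρ.re
  · apply Continuous.intervalIntegrable
    apply Continuous.log (by fun_prop)
    intro s h0
    rw [norm_eq_zero] at h0
    apply hy
    have := congrArg Complex.im h0
    simp at this
    linarith

/-- `t ↦ |log |t − t₀||` is integrable on every bounded interval. [folklore] -/
private theorem intervalIntegrable_abs_log_abs_sub (t₀ a b : ℝ) :
    IntervalIntegrable (fun t : ℝ ↦ |Real.log (|t - t₀|)|) volume a b := by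
  simp_rw [Real.log_abs]
  have h := (intervalIntegrable_log' (a := a - t₀) (b := b - t₀)).comp_sub_right t₀
  simp only [sub_add_cancel] at h
  exact h.abs

/-! ### Elementary majorants for `log ‖w‖` -/

/-- If `|t − t₀| ≤ r ≤ C` with `1 ≤ C` and `t ≠ t₀` then `|log r| ≤ |log |t − t₀|| + log C`.
[folklore] -/
private theorem abs_log_le_of_abs_sub_le {t t₀ r C : ℝ} (ht : t ≠ t₀) (hr : |t - t₀| ≤ r) (hC : r ≤ C)
    (hC1 : 1 ≤ C) : |Real.log r| ≤ |Real.log (|t - t₀|)| + Real.log C := by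
  have hpos : 0 < |t - t₀| := abs_pos.mpr (sub_ne_zero.mpr ht)
  have hr0 : 0 < r := hpos.trans_le hr
  have h1 : Real.log |t - t₀| ≤ Real.log r := Real.log_le_log hpos hr
  have h2 : Real.log r ≤ Real.log C := Real.log_le_log hr0 hC
  have h3 : 0 ≤ Real.log C := Real.log_nonneg hC1
  rw [abs_le]
  constructor
  · have := neg_abs_le (Real.log (|t - t₀|))
    linarith
  · have := abs_nonneg (Real.log (|t - t₀|))
    linarith

/-- If `κ ≤ r ≤ C` with `0 < κ` then `|log r| ≤ |log κ| + |log C|`. [folklore] -/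
private theorem abs_log_le_of_le_of_le {r κ C : ℝ} (hκ : 0 < κ) (hr : κ ≤ r) (hC : r ≤ C) :
    |Real.log r| ≤ |Real.log κ| + |Real.log C| := by
  have hr0 : 0 < r := hκ.trans_le hr
  have h1 : Real.log κ ≤ Real.log r := Real.log_le_log hκ hr
  have h2 : Real.log r ≤ Real.log C := Real.log_le_log hr0 hC
  rw [abs_le]
  constructor
  · have := neg_abs_le (Real.log κ)
    have := abs_nonneg (Real.log C)
    linarith
  · have := le_abs_self (Real.log C)
    have := abs_nonneg (Real.log κ)
    linarith

/-! ### Dominated convergence for the edge integrals of `log ‖z − ρ‖` -/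

/-- Dominated convergence for `∫_a^b φ(t) log ‖z(t) − uₙ‖ dt` as `uₙ → ρ`, given a majorant of
`|log ‖z(t) − uₙ‖|` off one point. [folklore] -/
private theorem tendsto_integral_mul_log_norm_sub {φ : ℝ → ℝ} {z : ℝ → ℂ} (hab : a ≤ b)
    (hφ : Continuous φ) (hz : Continuous z) {ρ : ℂ} {u : ℕ → ℂ}
    (hu : Tendsto u atTop (𝓝 ρ)) (hne : ∀ n, ∀ t ∈ Icc a b, z t ≠ u n)
    (hρ : {t | z t = ρ}.Countable) {t₀ : ℝ} {B : ℝ → ℝ} (hB : IntervalIntegrable B volume a b)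
    (hbound : ∀ n, ∀ t ∈ Icc a b, t ≠ t₀ → |Real.log ‖z t - u n‖| ≤ B t) :
    Tendsto (fun n ↦ ∫ t in a..b, φ t * Real.log ‖z t - u n‖) atTop
      (𝓝 (∫ t in a..b, φ t * Real.log ‖z t - ρ‖)) := by
  obtain ⟨M, hM⟩ := isCompact_Icc.exists_bound_of_continuousOn (hφ.continuousOn (s := Icc a b))
  have hM0 : 0 ≤ M := (norm_nonneg _).trans (hM a ⟨le_rfl, hab⟩)
  refine intervalIntegral.tendsto_integral_filter_of_dominated_convergence (fun t ↦ M * B t)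
    ?_ ?_ (hB.const_mul M) ?_
  · refine Eventually.of_forall fun n ↦ ?_
    have hcont : ContinuousOn (fun t ↦ φ t * Real.log ‖z t - u n‖) (Icc a b) := by
      refine hφ.continuousOn.mul (ContinuousOn.log ?_ ?_)
      · exact (hz.continuousOn.sub continuousOn_const).norm
      · intro t ht
        exact norm_ne_zero_iff.mpr (sub_ne_zero.mpr (hne n t ht))
    have hsub : Set.uIoc a b ⊆ Icc a b := by rw [uIoc_of_le hab]; exact Ioc_subset_Icc_self
    exact (hcont.mono hsub).aestronglyMeasurable measurableSet_uIoc
  · refine Eventually.of_forall fun n ↦ ?_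
    have hcount : ({t₀} : Set ℝ).Countable := Set.countable_singleton t₀
    filter_upwards [hcount.ae_notMem volume] with t ht0 ht
    rw [uIoc_of_le hab] at ht
    have htI : t ∈ Icc a b := Ioc_subset_Icc_self ht
    rw [norm_mul, Real.norm_eq_abs, Real.norm_eq_abs]
    exact mul_le_mul (hM t htI) (hbound n t htI ht0) (abs_nonneg _) hM0
  · filter_upwards [hρ.ae_notMem volume] with t htρ _
    have hne' : z t - ρ ≠ 0 := sub_ne_zero.mpr htρ
    have hcont : ContinuousAt (fun w : ℂ ↦ φ t * Real.log ‖z t - w‖) ρ := by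
      refine continuousAt_const.mul (ContinuousAt.log ?_ (norm_ne_zero_iff.mpr hne'))
      exact (continuousAt_const.sub continuousAt_id).norm
    exact hcont.tendsto.comp hu

/-- Dominated convergence for the right-edge term `∫ rightKernel(t) · log(W₁ + ti − uₙ) dt` as
`uₙ → ρ` from the left of the line `Re s = W₁`. [folklore] -/
private theorem tendsto_integral_rightKernel_mul_log {W₀ W₁ H : ℝ} (hH : 0 < H) {ρ : ℂ} {u : ℕ → ℂ}
    (hu : Tendsto u atTop (𝓝 ρ)) (hρ : ρ.re < W₁) (hre : ∀ n, (u n).re ≤ ρ.re) :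
    Tendsto (fun n ↦ ∫ t in (-H)..H, rightKernel W₀ W₁ H t * Complex.log ((W₁ : ℂ) + t * I - u n))
      atTop (𝓝 (∫ t in (-H)..H, rightKernel W₀ W₁ H t * Complex.log ((W₁ : ℂ) + t * I - ρ))) := by
  have hcd : -H ≤ H := by linarith
  have hrk : Continuous fun t : ℝ ↦ rightKernel W₀ W₁ H t := by unfold rightKernel; fun_prop
  obtain ⟨M, hM⟩ := isCompact_Icc.exists_bound_of_continuousOn (hrk.continuousOn (s := Icc (-H) H))
  have hM0 : 0 ≤ M := (norm_nonneg _).trans (hM (-H) ⟨le_rfl, hcd⟩)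
  set κ : ℝ := W₁ - ρ.re with hκ
  have hκ0 : 0 < κ := by rw [hκ]; linarith
  set C : ℝ := |W₁| + H + (‖ρ‖ + 1) with hC
  -- eventually `‖u n − ρ‖ ≤ 1`
  have hev : ∀ᶠ n in atTop, ‖u n - ρ‖ ≤ 1 := by
    have := (tendsto_iff_norm_sub_tendsto_zero.mp hu).eventually (ge_mem_nhds zero_lt_one)
    exact this
  -- lower and upper bounds for `‖W₁ + ti − u n‖`
  have hlow : ∀ n, ∀ t : ℝ, κ ≤ ‖(W₁ : ℂ) + t * I - u n‖ := by
    intro n t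
    refine le_trans ?_ (Complex.abs_re_le_norm _)
    have : ((W₁ : ℂ) + t * I - u n).re = W₁ - (u n).re := by simp
    rw [this, hκ]
    have := hre n
    rw [le_abs]
    left; linarith
  have hup : ∀ n, ‖u n - ρ‖ ≤ 1 → ∀ t ∈ Icc (-H) H, ‖(W₁ : ℂ) + t * I - u n‖ ≤ C := by
    intro n hn t ht
    have h1 : ‖(W₁ : ℂ) + t * I - u n‖ ≤ ‖(W₁ : ℂ)‖ + ‖(t : ℂ) * I‖ + ‖u n‖ := by
      calc ‖(W₁ : ℂ) + t * I - u n‖ ≤ ‖(W₁ : ℂ) + t * I‖ + ‖u n‖ := norm_sub_le _ _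
        _ ≤ ‖(W₁ : ℂ)‖ + ‖(t : ℂ) * I‖ + ‖u n‖ := by gcongr; exact norm_add_le _ _
    have h2 : ‖u n‖ ≤ ‖ρ‖ + 1 := by
      calc ‖u n‖ = ‖(u n - ρ) + ρ‖ := by ring_nf
        _ ≤ ‖u n - ρ‖ + ‖ρ‖ := norm_add_le _ _
        _ ≤ 1 + ‖ρ‖ := by gcongr
        _ = ‖ρ‖ + 1 := by ring
    have h3 : ‖(t : ℂ) * I‖ ≤ H := by
      rw [norm_mul, Complex.norm_I, mul_one, Complex.norm_real, Real.norm_eq_abs]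
      exact abs_le.mpr ⟨by linarith [ht.1], ht.2⟩
    rw [Complex.norm_real, Real.norm_eq_abs] at h1
    rw [hC]; linarith
  refine intervalIntegral.tendsto_integral_filter_of_dominated_convergence
    (fun _ ↦ M * (|Real.log κ| + |Real.log C| + Real.pi)) ?_ ?_ ?_ ?_
  · refine Eventually.of_forall fun n ↦ ?_
    have hcont : ContinuousOn
        (fun t : ℝ ↦ rightKernel W₀ W₁ H t * Complex.log ((W₁ : ℂ) + t * I - u n)) (Icc (-H) H) := by
      refine hrk.continuousOn.mul ?_
      intro t _
      refine (ContinuousAt.comp (g := Complex.log) ?_ ?_).continuousWithinAt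
      · apply continuousAt_clog
        left
        have : ((W₁ : ℂ) + t * I - u n).re = W₁ - (u n).re := by simp
        rw [this]; have := hre n; linarith
      · fun_prop
    have hsub : Set.uIoc (-H) H ⊆ Icc (-H) H := by rw [uIoc_of_le hcd]; exact Ioc_subset_Icc_self
    exact (hcont.mono hsub).aestronglyMeasurable measurableSet_uIoc
  · filter_upwards [hev] with n hn
    refine ae_of_all _ fun t ht ↦ ?_
    rw [uIoc_of_le hcd] at ht
    have htI : t ∈ Icc (-H) H := Ioc_subset_Icc_self ht
    rw [norm_mul]
    refine mul_le_mul (hM t htI) ?_ (norm_nonneg _) hM0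
    set w : ℂ := (W₁ : ℂ) + t * I - u n with hw
    have hwlog : ‖Complex.log w‖ ≤ |(Complex.log w).re| + |(Complex.log w).im| :=
      Complex.norm_le_abs_re_add_abs_im _
    have hre_log : (Complex.log w).re = Real.log ‖w‖ := Complex.log_re w
    have him_log : |(Complex.log w).im| ≤ Real.pi :=
      abs_le.mpr ⟨(Complex.neg_pi_lt_log_im w).le, Complex.log_im_le_pi w⟩
    have hnorm : |Real.log ‖w‖| ≤ |Real.log κ| + |Real.log C| :=
      abs_log_le_of_le_of_le hκ0 (hlow n t) (hup n hn t htI)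
    rw [hre_log] at hwlog
    linarith
  · exact intervalIntegrable_const
  · refine ae_of_all _ fun t _ ↦ ?_
    have hcont : ContinuousAt (fun w : ℂ ↦ rightKernel W₀ W₁ H t * Complex.log ((W₁ : ℂ) + t * I - w)) ρ := by
      refine continuousAt_const.mul (ContinuousAt.comp (g := Complex.log) ?_ ?_)
      · apply continuousAt_clog
        left
        have : ((W₁ : ℂ) + t * I - ρ).re = W₁ - ρ.re := by simp
        rw [this]; linarith
      · exact (continuousAt_const.sub continuousAt_id)
    exact hcont.tendsto.comp hu


/-! ### The right-hand side of Lemma 2.1 for a linear factor `s − ρ` -/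

/-- Crude norm bounds used for the majorants. [folklore] -/
private theorem norm_sub_le_of_norm_sub_le_one {p u ρ : ℂ} (h : ‖u - ρ‖ ≤ 1) :
    ‖p - u‖ ≤ ‖p‖ + ‖ρ‖ + 1 := by
  calc ‖p - u‖ = ‖p - ρ - (u - ρ)‖ := by ring_nf
    _ ≤ ‖p - ρ‖ + ‖u - ρ‖ := norm_sub_le _ _
    _ ≤ (‖p‖ + ‖ρ‖) + 1 := by gcongr; exact norm_sub_le _ _
    _ = ‖p‖ + ‖ρ‖ + 1 := by ring

/-- For `ρ` OUTSIDE the closed box (and to the left of the line `Re s = W₁`) the right-hand side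
of Lemma 2.1 for the linear function `s ↦ s − ρ`, with the principal branch of `log (W₁ + ti − ρ)`
on the right edge, vanishes: stage 1 with an empty zero set.
[cite: ConreySoundararajan2002, §2 Lemma 2.1 (proof)] -/
private theorem linear_rhs_eq_zero_of_not_mem {W₀ W₁ H : ℝ} (hH : 0 < H) (hW : W₀ < W₁) {ρ : ℂ}
    (hρ : ρ ∉ Icc W₀ W₁ ×ℂ Icc (-H) H) (hρre : ρ.re < W₁) :
    (∫ t in (-H)..H, Real.cos (Real.pi * t / (2 * H)) * Real.log ‖(W₀ : ℂ) + t * I - ρ‖) +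
      (∫ α in W₀..W₁, Real.sinh (Real.pi * (α - W₀) / (2 * H)) *
        Real.log ‖(α : ℂ) + H * I - ρ‖) +
      (∫ α in W₀..W₁, Real.sinh (Real.pi * (α - W₀) / (2 * H)) *
        Real.log ‖(α : ℂ) + ((-H : ℝ) : ℂ) * I - ρ‖) -
      (∫ t in (-H)..H, rightKernel W₀ W₁ H t * Complex.log ((W₁ : ℂ) + t * I - ρ)).re = 0 := by
  have hcd : -H ≤ H := by linarith
  have hf : AnalyticOnNhd ℂ (fun s : ℂ ↦ s - ρ) (Icc W₀ W₁ ×ℂ Icc (-H) H) := fun z _ ↦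
    analyticAt_id.sub analyticAt_const
  have hne : ∀ z ∈ Icc W₀ W₁ ×ℂ Icc (-H) H, z - ρ ≠ 0 := by
    intro z hz h
    rw [sub_eq_zero] at h
    exact hρ (h ▸ hz)
  have h_left : ∀ t ∈ Icc (-H) H, (W₀ : ℂ) + t * I - ρ ≠ 0 := fun t ht ↦
    hne _ ⟨by simpa using hW.le, by simpa using ht⟩
  have h_right : ∀ t ∈ Icc (-H) H, (W₁ : ℂ) + t * I - ρ ≠ 0 := fun t ht ↦
    hne _ ⟨by simpa using hW.le, by simpa using ht⟩
  have h_top : ∀ α ∈ Icc W₀ W₁, (α : ℂ) + H * I - ρ ≠ 0 := fun α hα ↦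
    hne _ ⟨by simpa using hα, by simpa using hcd⟩
  have h_bot : ∀ α ∈ Icc W₀ W₁, (α : ℂ) + ((-H : ℝ) : ℂ) * I - ρ ≠ 0 := fun α hα ↦
    hne _ ⟨by simpa using hα, by simpa using hcd⟩
  -- the principal branch on the right edge
  have hslit : ∀ t : ℝ, (W₁ : ℂ) + t * I - ρ ∈ slitPlane := fun t ↦ Or.inl (by simp; linarith)
  have hΛ : ContinuousOn (fun t : ℝ ↦ Complex.log ((W₁ : ℂ) + t * I - ρ)) (Icc (-H) H) := by
    intro t _
    have h1 : ContinuousAt (fun t : ℝ ↦ (W₁ : ℂ) + t * I - ρ) t := by fun_prop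
    exact (h1.clog (hslit t)).continuousWithinAt
  have hΛf : ∀ t ∈ Icc (-H) H, Complex.exp (Complex.log ((W₁ : ℂ) + t * I - ρ)) =
      (fun s : ℂ ↦ s - ρ) ((W₁ : ℂ) + t * I) := fun t ht ↦ by
    simp only [Complex.exp_log (h_right t ht)]
  have h1 := identity_of_ne_zero_on_boundary hH hW hf h_left h_right h_top h_bot hΛ hΛf
  have hZ : {z : ℂ | (fun s : ℂ ↦ s - ρ) z = 0 ∧ z ∈ Icc W₀ W₁ ×ℂ Icc (-H) H} = ∅ := by
    ext z
    simp only [mem_setOf_eq, mem_empty_iff_false, iff_false, not_and]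
    exact fun h hz ↦ hne z hz h
  rw [hZ, finsum_mem_empty, mul_zero] at h1
  -- split the horizontal logarithm
  have hbot_pt : ∀ α : ℝ, (α : ℂ) - H * I = α + ((-H : ℝ) : ℂ) * I := by
    intro α; push_cast; ring
  have hsq : Continuous fun α : ℝ ↦ Real.sinh (Real.pi * (α - W₀) / (2 * H)) := by fun_prop
  have hprod : (∫ α in W₀..W₁, Real.sinh (Real.pi * (α - W₀) / (2 * H)) *
      Real.log ‖((α : ℂ) + H * I - ρ) * ((α : ℂ) - H * I - ρ)‖) =
      (∫ α in W₀..W₁, Real.sinh (Real.pi * (α - W₀) / (2 * H)) *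
        Real.log ‖(α : ℂ) + H * I - ρ‖) +
      ∫ α in W₀..W₁, Real.sinh (Real.pi * (α - W₀) / (2 * H)) *
        Real.log ‖(α : ℂ) + ((-H : ℝ) : ℂ) * I - ρ‖ := by
    rw [← intervalIntegral.integral_add]
    · apply intervalIntegral.integral_congr
      intro α hα
      rw [uIcc_of_le hW.le] at hα
      simp only
      rw [hbot_pt α, norm_mul, Real.log_mul (norm_ne_zero_iff.2 (h_top α hα))
        (norm_ne_zero_iff.2 (h_bot α hα))]
      ring
    · exact (intervalIntegrable_log_norm_horizontal_sub H ρ W₀ W₁).continuousOn_mul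
        hsq.continuousOn
    · exact (intervalIntegrable_log_norm_horizontal_sub (-H) ρ W₀ W₁).continuousOn_mul
        hsq.continuousOn
  rw [hprod] at h1
  linarith

/-- The right-hand side of Lemma 2.1 for `s ↦ s − ρ` (principal branch on the right edge)
vanishes for `ρ` a limit of points outside the closed box, granted majorants for the three real
edge integrands (dominated convergence). [cite: ConreySoundararajan2002, §2 Lemma 2.1 (proof)] -/
private theorem linear_rhs_eq_zero_of_tendsto {W₀ W₁ H : ℝ} (hH : 0 < H) (hW : W₀ < W₁) {ρ : ℂ}
    (hρre : ρ.re < W₁) {u : ℕ → ℂ}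
    (hu : Tendsto u atTop (𝓝 ρ)) (hout : ∀ n, u n ∉ Icc W₀ W₁ ×ℂ Icc (-H) H)
    (hre : ∀ n, (u n).re ≤ ρ.re)
    {t₁ : ℝ} {B₁ : ℝ → ℝ} (hB₁ : IntervalIntegrable B₁ volume (-H) H)
    (hb₁ : ∀ n, ∀ t ∈ Icc (-H) H, t ≠ t₁ → |Real.log ‖(W₀ : ℂ) + t * I - u n‖| ≤ B₁ t)
    {t₂ : ℝ} {B₂ : ℝ → ℝ} (hB₂ : IntervalIntegrable B₂ volume W₀ W₁)
    (hb₂ : ∀ n, ∀ α ∈ Icc W₀ W₁, α ≠ t₂ → |Real.log ‖(α : ℂ) + H * I - u n‖| ≤ B₂ α)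
    {t₃ : ℝ} {B₃ : ℝ → ℝ} (hB₃ : IntervalIntegrable B₃ volume W₀ W₁)
    (hb₃ : ∀ n, ∀ α ∈ Icc W₀ W₁, α ≠ t₃ →
      |Real.log ‖(α : ℂ) + ((-H : ℝ) : ℂ) * I - u n‖| ≤ B₃ α) :
    (∫ t in (-H)..H, Real.cos (Real.pi * t / (2 * H)) * Real.log ‖(W₀ : ℂ) + t * I - ρ‖) +
      (∫ α in W₀..W₁, Real.sinh (Real.pi * (α - W₀) / (2 * H)) *
        Real.log ‖(α : ℂ) + H * I - ρ‖) +
      (∫ α in W₀..W₁, Real.sinh (Real.pi * (α - W₀) / (2 * H)) *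
        Real.log ‖(α : ℂ) + ((-H : ℝ) : ℂ) * I - ρ‖) -
      (∫ t in (-H)..H, rightKernel W₀ W₁ H t * Complex.log ((W₁ : ℂ) + t * I - ρ)).re = 0 := by
  have hcd : -H ≤ H := by linarith
  -- the edge points are in the closed box, hence differ from every `u n`
  have hne₁ : ∀ n, ∀ t ∈ Icc (-H) H, (W₀ : ℂ) + t * I ≠ u n := fun n t ht h ↦
    hout n (h ▸ ⟨by simpa using hW.le, by simpa using ht⟩)
  have hne₂ : ∀ n, ∀ α ∈ Icc W₀ W₁, (α : ℂ) + H * I ≠ u n := fun n α hα h ↦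
    hout n (h ▸ ⟨by simpa using hα, by simpa using hcd⟩)
  have hne₃ : ∀ n, ∀ α ∈ Icc W₀ W₁, (α : ℂ) + ((-H : ℝ) : ℂ) * I ≠ u n := fun n α hα h ↦
    hout n (h ▸ ⟨by simpa using hα, by simpa using hcd⟩)
  -- each edge meets `ρ` in at most one parameter value
  have hc₁ : {t : ℝ | (W₀ : ℂ) + t * I = ρ}.Countable := by
    refine (Set.countable_singleton ρ.im).mono fun t ht ↦ ?_
    have := congrArg Complex.im ht
    simpa using this
  have hc₂ : {α : ℝ | (α : ℂ) + H * I = ρ}.Countable := by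
    refine (Set.countable_singleton ρ.re).mono fun α hα ↦ ?_
    have := congrArg Complex.re hα
    simpa using this
  have hc₃ : {α : ℝ | (α : ℂ) + ((-H : ℝ) : ℂ) * I = ρ}.Countable := by
    refine (Set.countable_singleton ρ.re).mono fun α hα ↦ ?_
    have := congrArg Complex.re hα
    simpa using this
  have hT₁ := tendsto_integral_mul_log_norm_sub (φ := fun t ↦ Real.cos (Real.pi * t / (2 * H)))
    (z := fun t : ℝ ↦ (W₀ : ℂ) + t * I) hcd (by fun_prop) (by fun_prop) hu hne₁ hc₁ hB₁ hb₁
  have hT₂ := tendsto_integral_mul_log_norm_sub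
    (φ := fun α ↦ Real.sinh (Real.pi * (α - W₀) / (2 * H)))
    (z := fun α : ℝ ↦ (α : ℂ) + H * I) hW.le (by fun_prop) (by fun_prop) hu hne₂ hc₂ hB₂ hb₂
  have hT₃ := tendsto_integral_mul_log_norm_sub
    (φ := fun α ↦ Real.sinh (Real.pi * (α - W₀) / (2 * H)))
    (z := fun α : ℝ ↦ (α : ℂ) + ((-H : ℝ) : ℂ) * I) hW.le (by fun_prop) (by fun_prop) hu hne₃
    hc₃ hB₃ hb₃
  have hT₄ := (Complex.continuous_re.tendsto _).comp
    (tendsto_integral_rightKernel_mul_log (W₀ := W₀) hH hu hρre hre)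
  have hlim := ((hT₁.add hT₂).add hT₃).sub hT₄
  -- along the sequence the expression vanishes identically
  have hzero : ∀ n,
      (∫ t in (-H)..H, Real.cos (Real.pi * t / (2 * H)) * Real.log ‖(W₀ : ℂ) + t * I - u n‖) +
        (∫ α in W₀..W₁, Real.sinh (Real.pi * (α - W₀) / (2 * H)) *
          Real.log ‖(α : ℂ) + H * I - u n‖) +
        (∫ α in W₀..W₁, Real.sinh (Real.pi * (α - W₀) / (2 * H)) *
          Real.log ‖(α : ℂ) + ((-H : ℝ) : ℂ) * I - u n‖) -
        (∫ t in (-H)..H, rightKernel W₀ W₁ H t * Complex.log ((W₁ : ℂ) + t * I - u n)).re = 0 :=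
    fun n ↦ linear_rhs_eq_zero_of_not_mem hH hW (hout n) ((hre n).trans_lt hρre)
  simp only [Function.comp_def, hzero] at hlim
  exact tendsto_nhds_unique tendsto_const_nhds hlim |>.symm

/-! ### The three positions of a boundary zero -/

/-- `|t| ≤ |a| + |b|` for `t ∈ [a, b]`. [folklore] -/
private theorem abs_le_of_mem_Icc' {t a b : ℝ} (ht : t ∈ Icc a b) : |t| ≤ |a| + |b| := by
  rcases le_or_gt 0 t with h | h
  · rw [abs_of_nonneg h]; linarith [ht.2, le_abs_self b, abs_nonneg a]
  · rw [abs_of_neg h]; linarith [ht.1, neg_abs_le a, abs_nonneg b]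

/-- `‖x + yi‖ ≤ |x| + |y|`. [folklore] -/
private theorem norm_ofReal_add_ofReal_mul_I (x y : ℝ) : ‖(x : ℂ) + y * I‖ ≤ |x| + |y| := by
  calc ‖(x : ℂ) + y * I‖ ≤ ‖(x : ℂ)‖ + ‖(y : ℂ) * I‖ := norm_add_le _ _
    _ = |x| + |y| := by
        rw [norm_mul, Complex.norm_I, mul_one, Complex.norm_real, Complex.norm_real,
          Real.norm_eq_abs, Real.norm_eq_abs]

/-- Real part of `ρ + δ v` for real `δ`. [folklore] -/
private theorem re_add_ofReal_mul (ρ v : ℂ) (δ : ℝ) : (ρ + (δ : ℂ) * v).re = ρ.re + δ * v.re := by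
  simp [mul_re]

/-- Imaginary part of `ρ + δ v` for real `δ`. [folklore] -/
private theorem im_add_ofReal_mul (ρ v : ℂ) (δ : ℝ) : (ρ + (δ : ℂ) * v).im = ρ.im + δ * v.im := by
  simp [mul_im]

/-- The approximating sequence `ρ + v/(n+1)` (`‖v‖ = 1`): convergence and distance `≤ 1`.
[folklore] -/
private theorem tendsto_add_div_succ (ρ v : ℂ) :
    Tendsto (fun n : ℕ ↦ ρ + ((1 / ((n : ℝ) + 1) : ℝ) : ℂ) * v) atTop (𝓝 ρ) := by
  have h0 : Tendsto (fun n : ℕ ↦ 1 / ((n : ℝ) + 1)) atTop (𝓝 0) :=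
    tendsto_one_div_add_atTop_nhds_zero_nat
  have h1 : Tendsto (fun n : ℕ ↦ ((1 / ((n : ℝ) + 1) : ℝ) : ℂ)) atTop (𝓝 ((0 : ℝ) : ℂ)) :=
    (Complex.continuous_ofReal.tendsto 0).comp h0
  have h2 := tendsto_const_nhds (x := ρ) |>.add (h1.mul (tendsto_const_nhds (x := v)))
  simpa using h2

/-- `0 < 1/(n+1)`. [folklore] -/
private theorem one_div_succ_pos (n : ℕ) : 0 < 1 / ((n : ℝ) + 1) := by positivity

/-- `1/(n+1) ≤ 1`. [folklore] -/
private theorem one_div_succ_le_one (n : ℕ) : 1 / ((n : ℝ) + 1) ≤ 1 := by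
  rw [div_le_one (by positivity)]
  linarith [n.cast_nonneg (α := ℝ)]

/-- `‖(ρ + v/(n+1)) − ρ‖ ≤ 1` for `‖v‖ = 1`. [folklore] -/
private theorem norm_add_div_succ_sub (ρ v : ℂ) (hv : ‖v‖ = 1) (n : ℕ) :
    ‖ρ + ((1 / ((n : ℝ) + 1) : ℝ) : ℂ) * v - ρ‖ ≤ 1 := by
  rw [add_sub_cancel_left, norm_mul, hv, mul_one, Complex.norm_real, Real.norm_eq_abs,
    abs_of_pos (one_div_succ_pos n)]
  exact one_div_succ_le_one n

/-- **A zero on the top edge** (`Im ρ = H`, possibly the top-left corner): approach from above.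
[cite: ConreySoundararajan2002, §2 Lemma 2.1 (proof)] -/
private theorem linear_rhs_eq_zero_of_im_eq {W₀ W₁ H : ℝ} (hH : 0 < H) (hW : W₀ < W₁) {ρ : ℂ}
    (hρre : ρ.re < W₁) (hρim : ρ.im = H) :
    (∫ t in (-H)..H, Real.cos (Real.pi * t / (2 * H)) * Real.log ‖(W₀ : ℂ) + t * I - ρ‖) +
      (∫ α in W₀..W₁, Real.sinh (Real.pi * (α - W₀) / (2 * H)) *
        Real.log ‖(α : ℂ) + H * I - ρ‖) +
      (∫ α in W₀..W₁, Real.sinh (Real.pi * (α - W₀) / (2 * H)) *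
        Real.log ‖(α : ℂ) + ((-H : ℝ) : ℂ) * I - ρ‖) -
      (∫ t in (-H)..H, rightKernel W₀ W₁ H t * Complex.log ((W₁ : ℂ) + t * I - ρ)).re = 0 := by
  set u : ℕ → ℂ := fun n ↦ ρ + ((1 / ((n : ℝ) + 1) : ℝ) : ℂ) * I with hu_def
  have hu : Tendsto u atTop (𝓝 ρ) := tendsto_add_div_succ ρ I
  have hure : ∀ n, (u n).re = ρ.re := fun n ↦ by
    rw [show u n = ρ + ((1 / ((n : ℝ) + 1) : ℝ) : ℂ) * I from rfl, re_add_ofReal_mul]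
    simp
  have huim : ∀ n, (u n).im = H + 1 / ((n : ℝ) + 1) := fun n ↦ by
    rw [show u n = ρ + ((1 / ((n : ℝ) + 1) : ℝ) : ℂ) * I from rfl, im_add_ofReal_mul, I_im,
      mul_one, hρim]
  have hout : ∀ n, u n ∉ Icc W₀ W₁ ×ℂ Icc (-H) H := fun n h ↦ by
    have := h.2.2; rw [huim] at this; linarith [one_div_succ_pos n]
  have hnear : ∀ n, ‖u n - ρ‖ ≤ 1 := fun n ↦ norm_add_div_succ_sub ρ I (by simp) n
  set C : ℝ := |W₀| + |W₁| + (|-H| + |H|) + ‖ρ‖ + 2 with hC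
  have hC1 : 1 ≤ C := by
    rw [hC]; linarith [abs_nonneg W₀, abs_nonneg W₁, abs_nonneg (-H), abs_nonneg H, norm_nonneg ρ]
  -- upper bounds on the three edges
  have hup₁ : ∀ n, ∀ t ∈ Icc (-H) H, ‖(W₀ : ℂ) + t * I - u n‖ ≤ C := by
    intro n t ht
    have h1 := norm_sub_le_of_norm_sub_le_one (p := (W₀ : ℂ) + t * I) (hnear n)
    have h2 := norm_ofReal_add_ofReal_mul_I W₀ t
    have h3 := abs_le_of_mem_Icc' ht
    rw [hC]; linarith [abs_nonneg W₁]
  have hup₂ : ∀ n, ∀ α ∈ Icc W₀ W₁, ‖(α : ℂ) + H * I - u n‖ ≤ C := by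
    intro n α hα
    have h1 := norm_sub_le_of_norm_sub_le_one (p := (α : ℂ) + H * I) (hnear n)
    have h2 := norm_ofReal_add_ofReal_mul_I α H
    have h3 := abs_le_of_mem_Icc' hα
    rw [hC]; linarith [abs_nonneg (-H)]
  have hup₃ : ∀ n, ∀ α ∈ Icc W₀ W₁, ‖(α : ℂ) + ((-H : ℝ) : ℂ) * I - u n‖ ≤ C := by
    intro n α hα
    have h1 := norm_sub_le_of_norm_sub_le_one (p := (α : ℂ) + ((-H : ℝ) : ℂ) * I) (hnear n)
    have h2 := norm_ofReal_add_ofReal_mul_I α (-H)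
    have h3 := abs_le_of_mem_Icc' hα
    rw [hC]; linarith [abs_nonneg H]
  -- lower bounds
  have hlow₁ : ∀ n, ∀ t ∈ Icc (-H) H, |t - H| ≤ ‖(W₀ : ℂ) + t * I - u n‖ := by
    intro n t ht
    refine le_trans ?_ (Complex.abs_im_le_norm _)
    have : ((W₀ : ℂ) + t * I - u n).im = t - H - 1 / ((n : ℝ) + 1) := by
      rw [sub_im, huim]; simp; ring
    rw [this, abs_of_nonpos (by linarith [ht.2]), abs_of_nonpos (by linarith [ht.2, one_div_succ_pos n])]
    linarith [one_div_succ_pos n]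
  have hlow₂ : ∀ n, ∀ α ∈ Icc W₀ W₁, |α - ρ.re| ≤ ‖(α : ℂ) + H * I - u n‖ := by
    intro n α _
    refine le_trans (le_of_eq ?_) (Complex.abs_re_le_norm _)
    rw [sub_re, hure]; simp
  have hlow₃ : ∀ n, ∀ α ∈ Icc W₀ W₁, 2 * H ≤ ‖(α : ℂ) + ((-H : ℝ) : ℂ) * I - u n‖ := by
    intro n α _
    refine le_trans ?_ (Complex.abs_im_le_norm _)
    have : ((α : ℂ) + ((-H : ℝ) : ℂ) * I - u n).im = -(2 * H + 1 / ((n : ℝ) + 1)) := by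
      rw [sub_im, huim]; simp; ring
    rw [this, abs_neg, abs_of_pos (by linarith [one_div_succ_pos n])]
    linarith [one_div_succ_pos n]
  refine linear_rhs_eq_zero_of_tendsto hH hW hρre hu hout (fun n ↦ (hure n).le)
    (t₁ := H) (B₁ := fun t ↦ |Real.log (|t - H|)| + Real.log C)
    ((intervalIntegrable_abs_log_abs_sub H _ _).add intervalIntegrable_const)
    (fun n t ht hne ↦ abs_log_le_of_abs_sub_le hne (hlow₁ n t ht) (hup₁ n t ht) hC1)
    (t₂ := ρ.re) (B₂ := fun α ↦ |Real.log (|α - ρ.re|)| + Real.log C)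
    ((intervalIntegrable_abs_log_abs_sub ρ.re _ _).add intervalIntegrable_const)
    (fun n α hα hne ↦ abs_log_le_of_abs_sub_le hne (hlow₂ n α hα) (hup₂ n α hα) hC1)
    (t₃ := W₀) (B₃ := fun _ ↦ |Real.log (2 * H)| + |Real.log C|) intervalIntegrable_const
    (fun n α hα _ ↦ abs_log_le_of_le_of_le (by linarith) (hlow₃ n α hα) (hup₃ n α hα))

/-- **A zero on the bottom edge** (`Im ρ = −H`, possibly the bottom-left corner): approach from
below. [cite: ConreySoundararajan2002, §2 Lemma 2.1 (proof)] -/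
private theorem linear_rhs_eq_zero_of_im_eq_neg {W₀ W₁ H : ℝ} (hH : 0 < H) (hW : W₀ < W₁) {ρ : ℂ}
    (hρre : ρ.re < W₁) (hρim : ρ.im = -H) :
    (∫ t in (-H)..H, Real.cos (Real.pi * t / (2 * H)) * Real.log ‖(W₀ : ℂ) + t * I - ρ‖) +
      (∫ α in W₀..W₁, Real.sinh (Real.pi * (α - W₀) / (2 * H)) *
        Real.log ‖(α : ℂ) + H * I - ρ‖) +
      (∫ α in W₀..W₁, Real.sinh (Real.pi * (α - W₀) / (2 * H)) *
        Real.log ‖(α : ℂ) + ((-H : ℝ) : ℂ) * I - ρ‖) -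
      (∫ t in (-H)..H, rightKernel W₀ W₁ H t * Complex.log ((W₁ : ℂ) + t * I - ρ)).re = 0 := by
  set u : ℕ → ℂ := fun n ↦ ρ + ((1 / ((n : ℝ) + 1) : ℝ) : ℂ) * (-I) with hu_def
  have hu : Tendsto u atTop (𝓝 ρ) := tendsto_add_div_succ ρ (-I)
  have hure : ∀ n, (u n).re = ρ.re := fun n ↦ by
    rw [show u n = ρ + ((1 / ((n : ℝ) + 1) : ℝ) : ℂ) * (-I) from rfl, re_add_ofReal_mul]
    simp
  have huim : ∀ n, (u n).im = -H - 1 / ((n : ℝ) + 1) := fun n ↦ by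
    rw [show u n = ρ + ((1 / ((n : ℝ) + 1) : ℝ) : ℂ) * (-I) from rfl, im_add_ofReal_mul, neg_im,
      I_im, hρim]
    ring
  have hout : ∀ n, u n ∉ Icc W₀ W₁ ×ℂ Icc (-H) H := fun n h ↦ by
    have := h.2.1; rw [huim] at this; linarith [one_div_succ_pos n]
  have hnear : ∀ n, ‖u n - ρ‖ ≤ 1 := fun n ↦ norm_add_div_succ_sub ρ (-I) (by simp) n
  set C : ℝ := |W₀| + |W₁| + (|-H| + |H|) + ‖ρ‖ + 2 with hC
  have hC1 : 1 ≤ C := by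
    rw [hC]; linarith [abs_nonneg W₀, abs_nonneg W₁, abs_nonneg (-H), abs_nonneg H, norm_nonneg ρ]
  have hup₁ : ∀ n, ∀ t ∈ Icc (-H) H, ‖(W₀ : ℂ) + t * I - u n‖ ≤ C := by
    intro n t ht
    have h1 := norm_sub_le_of_norm_sub_le_one (p := (W₀ : ℂ) + t * I) (hnear n)
    have h2 := norm_ofReal_add_ofReal_mul_I W₀ t
    have h3 := abs_le_of_mem_Icc' ht
    rw [hC]; linarith [abs_nonneg W₁]
  have hup₂ : ∀ n, ∀ α ∈ Icc W₀ W₁, ‖(α : ℂ) + H * I - u n‖ ≤ C := by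
    intro n α hα
    have h1 := norm_sub_le_of_norm_sub_le_one (p := (α : ℂ) + H * I) (hnear n)
    have h2 := norm_ofReal_add_ofReal_mul_I α H
    have h3 := abs_le_of_mem_Icc' hα
    rw [hC]; linarith [abs_nonneg (-H)]
  have hup₃ : ∀ n, ∀ α ∈ Icc W₀ W₁, ‖(α : ℂ) + ((-H : ℝ) : ℂ) * I - u n‖ ≤ C := by
    intro n α hα
    have h1 := norm_sub_le_of_norm_sub_le_one (p := (α : ℂ) + ((-H : ℝ) : ℂ) * I) (hnear n)
    have h2 := norm_ofReal_add_ofReal_mul_I α (-H)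
    have h3 := abs_le_of_mem_Icc' hα
    rw [hC]; linarith [abs_nonneg H]
  have hlow₁ : ∀ n, ∀ t ∈ Icc (-H) H, |t - (-H)| ≤ ‖(W₀ : ℂ) + t * I - u n‖ := by
    intro n t ht
    refine le_trans ?_ (Complex.abs_im_le_norm _)
    have : ((W₀ : ℂ) + t * I - u n).im = t + H + 1 / ((n : ℝ) + 1) := by
      rw [sub_im, huim]; simp; ring
    rw [this, abs_of_nonneg (by linarith [ht.1]),
      abs_of_nonneg (by linarith [ht.1, one_div_succ_pos n])]
    linarith [one_div_succ_pos n]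
  have hlow₂ : ∀ n, ∀ α ∈ Icc W₀ W₁, 2 * H ≤ ‖(α : ℂ) + H * I - u n‖ := by
    intro n α _
    refine le_trans ?_ (Complex.abs_im_le_norm _)
    have : ((α : ℂ) + H * I - u n).im = 2 * H + 1 / ((n : ℝ) + 1) := by
      rw [sub_im, huim]; simp; ring
    rw [this, abs_of_pos (by linarith [one_div_succ_pos n])]
    linarith [one_div_succ_pos n]
  have hlow₃ : ∀ n, ∀ α ∈ Icc W₀ W₁, |α - ρ.re| ≤ ‖(α : ℂ) + ((-H : ℝ) : ℂ) * I - u n‖ := by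
    intro n α _
    refine le_trans (le_of_eq ?_) (Complex.abs_re_le_norm _)
    rw [sub_re, hure]; simp
  refine linear_rhs_eq_zero_of_tendsto hH hW hρre hu hout (fun n ↦ (hure n).le)
    (t₁ := -H) (B₁ := fun t ↦ |Real.log (|t - (-H)|)| + Real.log C)
    ((intervalIntegrable_abs_log_abs_sub (-H) _ _).add intervalIntegrable_const)
    (fun n t ht hne ↦ abs_log_le_of_abs_sub_le hne (hlow₁ n t ht) (hup₁ n t ht) hC1)
    (t₂ := W₀) (B₂ := fun _ ↦ |Real.log (2 * H)| + |Real.log C|) intervalIntegrable_const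
    (fun n α hα _ ↦ abs_log_le_of_le_of_le (by linarith) (hlow₂ n α hα) (hup₂ n α hα))
    (t₃ := ρ.re) (B₃ := fun α ↦ |Real.log (|α - ρ.re|)| + Real.log C)
    ((intervalIntegrable_abs_log_abs_sub ρ.re _ _).add intervalIntegrable_const)
    (fun n α hα hne ↦ abs_log_le_of_abs_sub_le hne (hlow₃ n α hα) (hup₃ n α hα) hC1)

/-- **A zero on the open left edge** (`Re ρ = W₀`, `|Im ρ| < H`): approach from the left.
[cite: ConreySoundararajan2002, §2 Lemma 2.1 (proof)] -/
private theorem linear_rhs_eq_zero_of_re_eq {W₀ W₁ H : ℝ} (hH : 0 < H) (hW : W₀ < W₁) {ρ : ℂ}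
    (hρre : ρ.re = W₀) (hρim₁ : -H < ρ.im) (hρim₂ : ρ.im < H) :
    (∫ t in (-H)..H, Real.cos (Real.pi * t / (2 * H)) * Real.log ‖(W₀ : ℂ) + t * I - ρ‖) +
      (∫ α in W₀..W₁, Real.sinh (Real.pi * (α - W₀) / (2 * H)) *
        Real.log ‖(α : ℂ) + H * I - ρ‖) +
      (∫ α in W₀..W₁, Real.sinh (Real.pi * (α - W₀) / (2 * H)) *
        Real.log ‖(α : ℂ) + ((-H : ℝ) : ℂ) * I - ρ‖) -
      (∫ t in (-H)..H, rightKernel W₀ W₁ H t * Complex.log ((W₁ : ℂ) + t * I - ρ)).re = 0 := by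
  set u : ℕ → ℂ := fun n ↦ ρ + ((1 / ((n : ℝ) + 1) : ℝ) : ℂ) * (-1) with hu_def
  have hu : Tendsto u atTop (𝓝 ρ) := tendsto_add_div_succ ρ (-1)
  have hure : ∀ n, (u n).re = W₀ - 1 / ((n : ℝ) + 1) := fun n ↦ by
    rw [show u n = ρ + ((1 / ((n : ℝ) + 1) : ℝ) : ℂ) * (-1) from rfl, re_add_ofReal_mul, neg_re,
      one_re, hρre]
    ring
  have huim : ∀ n, (u n).im = ρ.im := fun n ↦ by
    rw [show u n = ρ + ((1 / ((n : ℝ) + 1) : ℝ) : ℂ) * (-1) from rfl, im_add_ofReal_mul]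
    simp
  have hout : ∀ n, u n ∉ Icc W₀ W₁ ×ℂ Icc (-H) H := fun n h ↦ by
    have := h.1.1; rw [hure] at this; linarith [one_div_succ_pos n]
  have hnear : ∀ n, ‖u n - ρ‖ ≤ 1 := fun n ↦ norm_add_div_succ_sub ρ (-1) (by simp) n
  have hρre' : ρ.re < W₁ := by rw [hρre]; exact hW
  set C : ℝ := |W₀| + |W₁| + (|-H| + |H|) + ‖ρ‖ + 2 with hC
  have hC1 : 1 ≤ C := by
    rw [hC]; linarith [abs_nonneg W₀, abs_nonneg W₁, abs_nonneg (-H), abs_nonneg H, norm_nonneg ρ]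
  have hup₁ : ∀ n, ∀ t ∈ Icc (-H) H, ‖(W₀ : ℂ) + t * I - u n‖ ≤ C := by
    intro n t ht
    have h1 := norm_sub_le_of_norm_sub_le_one (p := (W₀ : ℂ) + t * I) (hnear n)
    have h2 := norm_ofReal_add_ofReal_mul_I W₀ t
    have h3 := abs_le_of_mem_Icc' ht
    rw [hC]; linarith [abs_nonneg W₁]
  have hup₂ : ∀ n, ∀ α ∈ Icc W₀ W₁, ‖(α : ℂ) + H * I - u n‖ ≤ C := by
    intro n α hα
    have h1 := norm_sub_le_of_norm_sub_le_one (p := (α : ℂ) + H * I) (hnear n)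
    have h2 := norm_ofReal_add_ofReal_mul_I α H
    have h3 := abs_le_of_mem_Icc' hα
    rw [hC]; linarith [abs_nonneg (-H)]
  have hup₃ : ∀ n, ∀ α ∈ Icc W₀ W₁, ‖(α : ℂ) + ((-H : ℝ) : ℂ) * I - u n‖ ≤ C := by
    intro n α hα
    have h1 := norm_sub_le_of_norm_sub_le_one (p := (α : ℂ) + ((-H : ℝ) : ℂ) * I) (hnear n)
    have h2 := norm_ofReal_add_ofReal_mul_I α (-H)
    have h3 := abs_le_of_mem_Icc' hα
    rw [hC]; linarith [abs_nonneg H]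
  have hlow₁ : ∀ n, ∀ t ∈ Icc (-H) H, |t - ρ.im| ≤ ‖(W₀ : ℂ) + t * I - u n‖ := by
    intro n t _
    refine le_trans (le_of_eq ?_) (Complex.abs_im_le_norm _)
    rw [sub_im, huim]; simp
  have hlow₂ : ∀ n, ∀ α ∈ Icc W₀ W₁, H - ρ.im ≤ ‖(α : ℂ) + H * I - u n‖ := by
    intro n α _
    refine le_trans (le_of_eq ?_) (Complex.abs_im_le_norm _)
    rw [sub_im, huim]; simp; rw [abs_of_pos (by linarith)]
  have hlow₃ : ∀ n, ∀ α ∈ Icc W₀ W₁, H + ρ.im ≤ ‖(α : ℂ) + ((-H : ℝ) : ℂ) * I - u n‖ := by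
    intro n α _
    refine le_trans (le_of_eq ?_) (Complex.abs_im_le_norm _)
    rw [sub_im, huim]; simp; rw [abs_of_neg (by linarith)]; ring
  refine linear_rhs_eq_zero_of_tendsto hH hW hρre' hu hout
    (fun n ↦ by rw [hure, hρre]; linarith [one_div_succ_pos n])
    (t₁ := ρ.im) (B₁ := fun t ↦ |Real.log (|t - ρ.im|)| + Real.log C)
    ((intervalIntegrable_abs_log_abs_sub ρ.im _ _).add intervalIntegrable_const)
    (fun n t ht hne ↦ abs_log_le_of_abs_sub_le hne (hlow₁ n t ht) (hup₁ n t ht) hC1)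
    (t₂ := W₀) (B₂ := fun _ ↦ |Real.log (H - ρ.im)| + |Real.log C|) intervalIntegrable_const
    (fun n α hα _ ↦ abs_log_le_of_le_of_le (by linarith) (hlow₂ n α hα) (hup₂ n α hα))
    (t₃ := W₀) (B₃ := fun _ ↦ |Real.log (H + ρ.im)| + |Real.log C|) intervalIntegrable_const
    (fun n α hα _ ↦ abs_log_le_of_le_of_le (by linarith) (hlow₃ n α hα) (hup₃ n α hα))

/-- **The linear-factor identity.** For `ρ` on the boundary of the box but not on its right edge,
the right-hand side of Lemma 2.1 for `s ↦ s − ρ` with the principal branch on the right edge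
vanishes — consistent with the zero `ρ` carrying Selberg weight `0` there.
[cite: ConreySoundararajan2002, §2 Lemma 2.1 (proof)] -/
theorem linear_rhs_eq_zero_of_mem_frontier {W₀ W₁ H : ℝ} (hH : 0 < H) (hW : W₀ < W₁) {ρ : ℂ}
    (hρK : ρ ∈ Icc W₀ W₁ ×ℂ Icc (-H) H) (hρ : ρ ∉ Ioo W₀ W₁ ×ℂ Ioo (-H) H) (hρre : ρ.re < W₁) :
    (∫ t in (-H)..H, Real.cos (Real.pi * t / (2 * H)) * Real.log ‖(W₀ : ℂ) + t * I - ρ‖) +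
      (∫ α in W₀..W₁, Real.sinh (Real.pi * (α - W₀) / (2 * H)) *
        Real.log ‖(α : ℂ) + H * I - ρ‖) +
      (∫ α in W₀..W₁, Real.sinh (Real.pi * (α - W₀) / (2 * H)) *
        Real.log ‖(α : ℂ) + ((-H : ℝ) : ℂ) * I - ρ‖) -
      (∫ t in (-H)..H, rightKernel W₀ W₁ H t * Complex.log ((W₁ : ℂ) + t * I - ρ)).re = 0 := by
  obtain ⟨⟨hre₁, hre₂⟩, ⟨him₁, him₂⟩⟩ := hρK
  by_cases htop : ρ.im = H
  · exact linear_rhs_eq_zero_of_im_eq hH hW hρre htop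
  by_cases hbot : ρ.im = -H
  · exact linear_rhs_eq_zero_of_im_eq_neg hH hW hρre hbot
  have him₁' : -H < ρ.im := lt_of_le_of_ne him₁ (Ne.symm hbot)
  have him₂' : ρ.im < H := lt_of_le_of_ne him₂ htop
  have hre : ρ.re = W₀ := by
    by_contra hne
    have hre₁' : W₀ < ρ.re := lt_of_le_of_ne hre₁ (Ne.symm hne)
    exact hρ ⟨⟨hre₁', hρre⟩, ⟨him₁', him₂'⟩⟩
  exact linear_rhs_eq_zero_of_re_eq hH hW hre him₁' him₂'

/-! ### Dividing out the boundary zeros -/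

/-- **Lemma 2.1 with boundary zeros allowed**, split form, by induction on a finite set `S`
containing the boundary zeros: for `f` analytic at every point of the closed box and non-zero on
the right edge, the three `log ‖f‖` edge integrands are integrable and the identity holds for
every continuous branch `Λ` of `log f` on the right edge. Step: divide out `(s − ρ)^{m(ρ)}` at a
boundary zero `ρ` (Selberg weight `0` there; `linear_rhs_eq_zero_of_mem_frontier` for the factor).
[cite: ConreySoundararajan2002, §2 Lemma 2.1 (proof)] -/
theorem identity_split_aux {W₀ W₁ H : ℝ} (hH : 0 < H) (hW : W₀ < W₁) (S : Finset ℂ) :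
    ∀ f : ℂ → ℂ, AnalyticOnNhd ℂ f (Icc W₀ W₁ ×ℂ Icc (-H) H) →
      (∀ t ∈ Icc (-H) H, f ((W₁ : ℂ) + t * I) ≠ 0) →
      (∀ z ∈ Icc W₀ W₁ ×ℂ Icc (-H) H, f z = 0 → z ∉ Ioo W₀ W₁ ×ℂ Ioo (-H) H → z ∈ S) →
      IntervalIntegrable (fun t : ℝ ↦ Real.log ‖f ((W₀ : ℂ) + t * I)‖) volume (-H) H ∧
      IntervalIntegrable (fun α : ℝ ↦ Real.log ‖f ((α : ℂ) + H * I)‖) volume W₀ W₁ ∧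
      IntervalIntegrable (fun α : ℝ ↦ Real.log ‖f ((α : ℂ) + ((-H : ℝ) : ℂ) * I)‖) volume W₀ W₁ ∧
      ∀ Λ : ℝ → ℂ, ContinuousOn Λ (Icc (-H) H) →
        (∀ t ∈ Icc (-H) H, Complex.exp (Λ t) = f ((W₁ : ℂ) + t * I)) →
        4 * H * ∑ᶠ ρ ∈ {ρ : ℂ | f ρ = 0 ∧ ρ ∈ Icc W₀ W₁ ×ℂ Icc (-H) H},
            (analyticOrderNatAt f ρ : ℝ) * weight W₀ H ρ =
          (∫ t in (-H)..H, Real.cos (Real.pi * t / (2 * H)) * Real.log ‖f ((W₀ : ℂ) + t * I)‖) +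
            (∫ α in W₀..W₁, Real.sinh (Real.pi * (α - W₀) / (2 * H)) *
              Real.log ‖f ((α : ℂ) + H * I)‖) +
            (∫ α in W₀..W₁, Real.sinh (Real.pi * (α - W₀) / (2 * H)) *
              Real.log ‖f ((α : ℂ) + ((-H : ℝ) : ℂ) * I)‖) -
            (∫ t in (-H)..H, rightKernel W₀ W₁ H t * Λ t).re := by
  have hHne : H ≠ 0 := hH.ne'
  have hcd : -H < H := by linarith
  have hsq : Continuous fun α : ℝ ↦ Real.sinh (Real.pi * (α - W₀) / (2 * H)) := by fun_prop
  have hcp : Continuous fun t : ℝ ↦ Real.cos (Real.pi * t / (2 * H)) := by fun_prop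
  -- edge points are in the closed box and off the open box
  have hK_left : ∀ t ∈ Icc (-H) H, ((W₀ : ℂ) + t * I) ∈ Icc W₀ W₁ ×ℂ Icc (-H) H := fun t ht ↦
    ⟨by simpa using hW.le, by simpa using ht⟩
  have hK_right : ∀ t ∈ Icc (-H) H, ((W₁ : ℂ) + t * I) ∈ Icc W₀ W₁ ×ℂ Icc (-H) H := fun t ht ↦
    ⟨by simpa using hW.le, by simpa using ht⟩
  have hK_top : ∀ α ∈ Icc W₀ W₁, ((α : ℂ) + H * I) ∈ Icc W₀ W₁ ×ℂ Icc (-H) H := fun α hα ↦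
    ⟨by simpa using hα, by simpa using hcd.le⟩
  have hK_bot : ∀ α ∈ Icc W₀ W₁, ((α : ℂ) + ((-H : ℝ) : ℂ) * I) ∈ Icc W₀ W₁ ×ℂ Icc (-H) H :=
    fun α hα ↦ ⟨by simpa using hα, by simpa using hcd.le⟩
  have hO_left : ∀ t : ℝ, ((W₀ : ℂ) + t * I) ∉ Ioo W₀ W₁ ×ℂ Ioo (-H) H := fun t h ↦ by
    have := h.1.1; simp at this
  have hO_top : ∀ α : ℝ, ((α : ℂ) + H * I) ∉ Ioo W₀ W₁ ×ℂ Ioo (-H) H := fun α h ↦ by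
    have := h.2.2; simp at this
  have hO_bot : ∀ α : ℝ, ((α : ℂ) + ((-H : ℝ) : ℂ) * I) ∉ Ioo W₀ W₁ ×ℂ Ioo (-H) H := fun α h ↦ by
    have := h.2.1; simp at this
  induction S using Finset.induction_on with
  | empty =>
    intro f hf hright hbd
    have h_left : ∀ t ∈ Icc (-H) H, f ((W₀ : ℂ) + t * I) ≠ 0 := fun t ht h0 ↦
      (Finset.notMem_empty _) (hbd _ (hK_left t ht) h0 (hO_left t))
    have h_top : ∀ α ∈ Icc W₀ W₁, f ((α : ℂ) + H * I) ≠ 0 := fun α hα h0 ↦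
      (Finset.notMem_empty _) (hbd _ (hK_top α hα) h0 (hO_top α))
    have h_bot : ∀ α ∈ Icc W₀ W₁, f ((α : ℂ) + ((-H : ℝ) : ℂ) * I) ≠ 0 := fun α hα h0 ↦
      (Finset.notMem_empty _) (hbd _ (hK_bot α hα) h0 (hO_bot α))
    have hLl : ContinuousOn (fun t : ℝ ↦ Real.log ‖f ((W₀ : ℂ) + t * I)‖) (Icc (-H) H) :=
      fun t ht ↦ ((((hf _ (hK_left t ht)).continuousAt.comp
        (f := fun t : ℝ ↦ (W₀ : ℂ) + t * I) (by fun_prop)).norm).log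
        (norm_ne_zero_iff.2 (h_left t ht))).continuousWithinAt
    have hLt : ContinuousOn (fun α : ℝ ↦ Real.log ‖f ((α : ℂ) + H * I)‖) (Icc W₀ W₁) :=
      fun α hα ↦ ((((hf _ (hK_top α hα)).continuousAt.comp
        (f := fun α : ℝ ↦ (α : ℂ) + H * I) (by fun_prop)).norm).log
        (norm_ne_zero_iff.2 (h_top α hα))).continuousWithinAt
    have hLb : ContinuousOn (fun α : ℝ ↦ Real.log ‖f ((α : ℂ) + ((-H : ℝ) : ℂ) * I)‖)
        (Icc W₀ W₁) :=
      fun α hα ↦ ((((hf _ (hK_bot α hα)).continuousAt.comp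
        (f := fun α : ℝ ↦ (α : ℂ) + ((-H : ℝ) : ℂ) * I) (by fun_prop)).norm).log
        (norm_ne_zero_iff.2 (h_bot α hα))).continuousWithinAt
    refine ⟨hLl.intervalIntegrable_of_Icc hcd.le, hLt.intervalIntegrable_of_Icc hW.le,
      hLb.intervalIntegrable_of_Icc hW.le, fun Λ hΛ hΛf ↦ ?_⟩
    have h1 := identity_of_ne_zero_on_boundary hH hW hf h_left hright h_top h_bot hΛ hΛf
    have hbot_pt : ∀ α : ℝ, (α : ℂ) - H * I = α + ((-H : ℝ) : ℂ) * I := by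
      intro α; push_cast; ring
    have hprod : (∫ α in W₀..W₁, Real.sinh (Real.pi * (α - W₀) / (2 * H)) *
        Real.log ‖f ((α : ℂ) + H * I) * f ((α : ℂ) - H * I)‖) =
        (∫ α in W₀..W₁, Real.sinh (Real.pi * (α - W₀) / (2 * H)) *
          Real.log ‖f ((α : ℂ) + H * I)‖) +
        ∫ α in W₀..W₁, Real.sinh (Real.pi * (α - W₀) / (2 * H)) *
          Real.log ‖f ((α : ℂ) + ((-H : ℝ) : ℂ) * I)‖ := by
      rw [← intervalIntegral.integral_add]
      · apply intervalIntegral.integral_congr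
        intro α hα
        rw [uIcc_of_le hW.le] at hα
        simp only
        rw [hbot_pt α, norm_mul, Real.log_mul (norm_ne_zero_iff.2 (h_top α hα))
          (norm_ne_zero_iff.2 (h_bot α hα))]
        ring
      · exact (hsq.continuousOn.mul hLt).intervalIntegrable_of_Icc hW.le
      · exact (hsq.continuousOn.mul hLb).intervalIntegrable_of_Icc hW.le
    rw [hprod] at h1
    linarith
  | insert ρ S' hρS' ih =>
    intro f hf hright hbd
    by_cases hρ0 : f ρ = 0 ∧ ρ ∈ Icc W₀ W₁ ×ℂ Icc (-H) H ∧ ρ ∉ Ioo W₀ W₁ ×ℂ Ioo (-H) H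
    swap
    · -- `ρ` is not a boundary zero of `f`: the boundary zeros lie in `S'`
      refine ih f hf hright fun z hz h0 hO ↦ ?_
      have h := hbd z hz h0 hO
      rw [Finset.mem_insert] at h
      rcases h with rfl | h
      · exact absurd ⟨h0, hz, hO⟩ hρ0
      · exact h
    obtain ⟨hfρ, hρK, hρO⟩ := hρ0
    -- `ρ` is to the left of the right edge
    have hρre : ρ.re < W₁ := by
      rcases hρK.1.2.eq_or_lt with h | h
      · exfalso
        apply hright ρ.im hρK.2
        have : (W₁ : ℂ) + ρ.im * I = ρ := by rw [← h]; exact re_add_im ρ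
        rw [this]; exact hfρ
      · exact h
    -- local factorisation of `f` at `ρ`
    have h0mem : (0 : ℝ) ∈ Icc (-H) H := ⟨by linarith, hH.le⟩
    have hw : f ((W₁ : ℂ) + (0 : ℝ) * I) ≠ 0 := hright 0 h0mem
    have hne_top : analyticOrderAt f ρ ≠ ⊤ :=
      analyticOrderAt_ne_top_of_reProdIm hW.le hcd.le hf (hK_right 0 h0mem) hw hρK
    obtain ⟨g₀, hg₀_an, hg₀_ne, hfg₀⟩ := (hf ρ hρK).analyticOrderAt_ne_top.mp hne_top
    set m : ℕ := analyticOrderNatAt f ρ with hm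
    set f₁ : ℂ → ℂ := fun z ↦ if z = ρ then g₀ ρ else f z / (z - ρ) ^ m with hf₁_def
    have hf₁_of_ne : ∀ z, z ≠ ρ → f₁ z = f z / (z - ρ) ^ m := fun z hz ↦ by
      simp [hf₁_def, hz]
    have hf_eq : ∀ z, z ≠ ρ → f z = (z - ρ) ^ m * f₁ z := fun z hz ↦ by
      rw [hf₁_of_ne z hz, mul_div_cancel₀ _ (pow_ne_zero _ (sub_ne_zero.2 hz))]
    have hf₁ρ : f₁ =ᶠ[𝓝 ρ] g₀ := by
      filter_upwards [hfg₀] with z hz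
      by_cases hzρ : z = ρ
      · subst hzρ; simp [hf₁_def]
      · rw [hf₁_of_ne z hzρ, hz, smul_eq_mul, mul_div_cancel_left₀ _
          (pow_ne_zero _ (sub_ne_zero.2 hzρ))]
    have hf_ev : ∀ z, z ≠ ρ → f =ᶠ[𝓝 z] fun w ↦ (w - ρ) ^ m * f₁ w := fun z hz ↦
      (isOpen_ne.eventually_mem hz).mono fun w hw ↦ hf_eq w hw
    have hf₁_an : AnalyticOnNhd ℂ f₁ (Icc W₀ W₁ ×ℂ Icc (-H) H) := by
      intro z hz
      by_cases hzρ : z = ρ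
      · subst hzρ
        exact hg₀_an.congr hf₁ρ.symm
      · have h1 : AnalyticAt ℂ (fun w ↦ f w / (w - ρ) ^ m) z :=
          (hf z hz).div ((analyticAt_id.sub analyticAt_const).pow m)
            (pow_ne_zero _ (sub_ne_zero.2 hzρ))
        refine h1.congr ?_
        exact (isOpen_ne.eventually_mem hzρ).mono fun w hw ↦ (hf₁_of_ne w hw).symm
    have hf₁ρ_ne : f₁ ρ ≠ 0 := by simp [hf₁_def, hg₀_ne]
    have hzero₁ : ∀ z, f₁ z = 0 ↔ z ≠ ρ ∧ f z = 0 := by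
      intro z
      by_cases hzρ : z = ρ
      · subst hzρ
        simp only [ne_eq, not_true_eq_false, false_and, iff_false]
        exact hf₁ρ_ne
      · rw [hf_eq z hzρ]
        constructor
        · intro h; exact ⟨hzρ, by rw [h, mul_zero]⟩
        · rintro ⟨-, h⟩
          rcases mul_eq_zero.mp h with h | h
          · exact absurd h (pow_ne_zero _ (sub_ne_zero.2 hzρ))
          · exact h
    have hright₁ : ∀ t ∈ Icc (-H) H, f₁ ((W₁ : ℂ) + t * I) ≠ 0 := fun t ht h ↦
      hright t ht ((hzero₁ _).mp h).2
    have hbd₁ : ∀ z ∈ Icc W₀ W₁ ×ℂ Icc (-H) H, f₁ z = 0 → z ∉ Ioo W₀ W₁ ×ℂ Ioo (-H) H →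
        z ∈ S' := by
      intro z hz h0 hO
      obtain ⟨hzρ, hfz⟩ := (hzero₁ z).mp h0
      have h := hbd z hz hfz hO
      rw [Finset.mem_insert] at h
      exact h.resolve_left hzρ
    obtain ⟨hI₁, hI₂, hI₃, hEQ⟩ := ih f₁ hf₁_an hright₁ hbd₁
    -- `log ‖f‖ = m log ‖· − ρ‖ + log ‖f₁‖` off the zeros of `f`
    have hlog : ∀ z, f z ≠ 0 → Real.log ‖f z‖ = m * Real.log ‖z - ρ‖ + Real.log ‖f₁ z‖ := by
      intro z hz
      have hzρ : z ≠ ρ := fun h ↦ hz (h ▸ hfρ)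
      have hf₁z : f₁ z ≠ 0 := fun h ↦ hz (by rw [hf_eq z hzρ, h, mul_zero])
      rw [hf_eq z hzρ, norm_mul, norm_pow,
        Real.log_mul (pow_ne_zero _ (norm_ne_zero_iff.2 (sub_ne_zero.2 hzρ)))
          (norm_ne_zero_iff.2 hf₁z), Real.log_pow]
    -- the zeros of `f` on the three edges form finite sets of parameters
    have hfinK := finite_zeros_closed_reProdIm hW.le hcd.le hf (hK_right 0 h0mem) hw
    have hT₁ : {t : ℝ | t ∈ Icc (-H) H ∧ f ((W₀ : ℂ) + t * I) = 0}.Finite := by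
      refine Set.Finite.of_finite_image (f := fun t : ℝ ↦ (W₀ : ℂ) + t * I) ?_ ?_
      · refine hfinK.subset ?_
        rintro _ ⟨t, ⟨ht, h0⟩, rfl⟩
        exact ⟨h0, hK_left t ht⟩
      · intro t _ s _ h
        simpa using congrArg Complex.im h
    have hT₂ : {α : ℝ | α ∈ Icc W₀ W₁ ∧ f ((α : ℂ) + H * I) = 0}.Finite := by
      refine Set.Finite.of_finite_image (f := fun α : ℝ ↦ (α : ℂ) + H * I) ?_ ?_
      · refine hfinK.subset ?_
        rintro _ ⟨α, ⟨hα, h0⟩, rfl⟩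
        exact ⟨h0, hK_top α hα⟩
      · intro α _ β _ h
        simpa using congrArg Complex.re h
    have hT₃ : {α : ℝ | α ∈ Icc W₀ W₁ ∧ f ((α : ℂ) + ((-H : ℝ) : ℂ) * I) = 0}.Finite := by
      refine Set.Finite.of_finite_image (f := fun α : ℝ ↦ (α : ℂ) + ((-H : ℝ) : ℂ) * I) ?_ ?_
      · refine hfinK.subset ?_
        rintro _ ⟨α, ⟨hα, h0⟩, rfl⟩
        exact ⟨h0, hK_bot α hα⟩
      · intro α _ β _ h
        simpa using congrArg Complex.re h
    -- the a.e. identities along the three edges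
    have hae₁ : ∀ᵐ t ∂volume, t ∈ Set.uIoc (-H) H →
        Real.cos (Real.pi * t / (2 * H)) * Real.log ‖f ((W₀ : ℂ) + t * I)‖ =
          (m : ℝ) * (Real.cos (Real.pi * t / (2 * H)) * Real.log ‖(W₀ : ℂ) + t * I - ρ‖) +
            Real.cos (Real.pi * t / (2 * H)) * Real.log ‖f₁ ((W₀ : ℂ) + t * I)‖ := by
      filter_upwards [hT₁.countable.ae_notMem volume] with t htT ht
      rw [uIoc_of_le hcd.le] at ht
      have hft : f ((W₀ : ℂ) + t * I) ≠ 0 := fun h0 ↦ htT ⟨Ioc_subset_Icc_self ht, h0⟩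
      rw [hlog _ hft]
      ring
    have hae₂ : ∀ᵐ α ∂volume, α ∈ Set.uIoc W₀ W₁ →
        Real.sinh (Real.pi * (α - W₀) / (2 * H)) * Real.log ‖f ((α : ℂ) + H * I)‖ =
          (m : ℝ) * (Real.sinh (Real.pi * (α - W₀) / (2 * H)) *
            Real.log ‖(α : ℂ) + H * I - ρ‖) +
            Real.sinh (Real.pi * (α - W₀) / (2 * H)) * Real.log ‖f₁ ((α : ℂ) + H * I)‖ := by
      filter_upwards [hT₂.countable.ae_notMem volume] with α hαT hα
      rw [uIoc_of_le hW.le] at hα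
      have hfα : f ((α : ℂ) + H * I) ≠ 0 := fun h0 ↦ hαT ⟨Ioc_subset_Icc_self hα, h0⟩
      rw [hlog _ hfα]
      ring
    have hae₃ : ∀ᵐ α ∂volume, α ∈ Set.uIoc W₀ W₁ →
        Real.sinh (Real.pi * (α - W₀) / (2 * H)) *
            Real.log ‖f ((α : ℂ) + ((-H : ℝ) : ℂ) * I)‖ =
          (m : ℝ) * (Real.sinh (Real.pi * (α - W₀) / (2 * H)) *
            Real.log ‖(α : ℂ) + ((-H : ℝ) : ℂ) * I - ρ‖) +
            Real.sinh (Real.pi * (α - W₀) / (2 * H)) *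
              Real.log ‖f₁ ((α : ℂ) + ((-H : ℝ) : ℂ) * I)‖ := by
      filter_upwards [hT₃.countable.ae_notMem volume] with α hαT hα
      rw [uIoc_of_le hW.le] at hα
      have hfα : f ((α : ℂ) + ((-H : ℝ) : ℂ) * I) ≠ 0 := fun h0 ↦
        hαT ⟨Ioc_subset_Icc_self hα, h0⟩
      rw [hlog _ hfα]
      ring
    -- integrability of the three edge logarithms of `f`
    have hJ₁ : IntervalIntegrable (fun t : ℝ ↦ Real.log ‖(W₀ : ℂ) + t * I - ρ‖) volume (-H) H :=
      intervalIntegrable_log_norm_vertical_sub W₀ ρ _ _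
    have hJ₂ : IntervalIntegrable (fun α : ℝ ↦ Real.log ‖(α : ℂ) + H * I - ρ‖) volume W₀ W₁ :=
      intervalIntegrable_log_norm_horizontal_sub H ρ _ _
    have hJ₃ : IntervalIntegrable (fun α : ℝ ↦ Real.log ‖(α : ℂ) + ((-H : ℝ) : ℂ) * I - ρ‖)
        volume W₀ W₁ :=
      intervalIntegrable_log_norm_horizontal_sub (-H) ρ _ _
    have hI₁f : IntervalIntegrable (fun t : ℝ ↦ Real.log ‖f ((W₀ : ℂ) + t * I)‖)
        volume (-H) H := by
      refine ((hJ₁.const_mul (m : ℝ)).add hI₁).congr_ae ?_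
      rw [Filter.EventuallyEq, ae_restrict_iff' measurableSet_uIoc]
      filter_upwards [hT₁.countable.ae_notMem volume] with t htT ht
      rw [uIoc_of_le hcd.le] at ht
      have hft : f ((W₀ : ℂ) + t * I) ≠ 0 := fun h0 ↦ htT ⟨Ioc_subset_Icc_self ht, h0⟩
      rw [hlog _ hft]
    have hI₂f : IntervalIntegrable (fun α : ℝ ↦ Real.log ‖f ((α : ℂ) + H * I)‖)
        volume W₀ W₁ := by
      refine ((hJ₂.const_mul (m : ℝ)).add hI₂).congr_ae ?_
      rw [Filter.EventuallyEq, ae_restrict_iff' measurableSet_uIoc]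
      filter_upwards [hT₂.countable.ae_notMem volume] with α hαT hα
      rw [uIoc_of_le hW.le] at hα
      have hfα : f ((α : ℂ) + H * I) ≠ 0 := fun h0 ↦ hαT ⟨Ioc_subset_Icc_self hα, h0⟩
      rw [hlog _ hfα]
    have hI₃f : IntervalIntegrable (fun α : ℝ ↦ Real.log ‖f ((α : ℂ) + ((-H : ℝ) : ℂ) * I)‖)
        volume W₀ W₁ := by
      refine ((hJ₃.const_mul (m : ℝ)).add hI₃).congr_ae ?_
      rw [Filter.EventuallyEq, ae_restrict_iff' measurableSet_uIoc]
      filter_upwards [hT₃.countable.ae_notMem volume] with α hαT hα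
      rw [uIoc_of_le hW.le] at hα
      have hfα : f ((α : ℂ) + ((-H : ℝ) : ℂ) * I) ≠ 0 := fun h0 ↦
        hαT ⟨Ioc_subset_Icc_self hα, h0⟩
      rw [hlog _ hfα]
    refine ⟨hI₁f, hI₂f, hI₃f, fun Λ hΛ hΛf ↦ ?_⟩
    -- the branch for `f₁` on the right edge
    have hslit : ∀ t : ℝ, (W₁ : ℂ) + t * I - ρ ∈ slitPlane := fun t ↦ Or.inl (by simp; linarith)
    have hright_ne : ∀ t : ℝ, (W₁ : ℂ) + t * I - ρ ≠ 0 := fun t ↦ slitPlane_ne_zero (hslit t)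
    have hlogc : ContinuousOn (fun t : ℝ ↦ Complex.log ((W₁ : ℂ) + t * I - ρ)) (Icc (-H) H) := by
      intro t _
      have h1 : ContinuousAt (fun t : ℝ ↦ (W₁ : ℂ) + t * I - ρ) t := by fun_prop
      exact (h1.clog (hslit t)).continuousWithinAt
    set Λ₁ : ℝ → ℂ := fun t ↦ Λ t - m * Complex.log ((W₁ : ℂ) + t * I - ρ) with hΛ₁
    have hΛ₁c : ContinuousOn Λ₁ (Icc (-H) H) := hΛ.sub (continuousOn_const.mul hlogc)
    have hΛ₁f : ∀ t ∈ Icc (-H) H, Complex.exp (Λ₁ t) = f₁ ((W₁ : ℂ) + t * I) := by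
      intro t ht
      have hne : (W₁ : ℂ) + t * I ≠ ρ := fun h ↦ hright_ne t (by rw [h, sub_self])
      rw [hΛ₁]
      simp only
      rw [Complex.exp_sub, hΛf t ht, Complex.exp_nat_mul, Complex.exp_log (hright_ne t),
        hf_eq _ hne, mul_div_cancel_left₀ _ (pow_ne_zero _ (hright_ne t))]
    have hE₁ := hEQ Λ₁ hΛ₁c hΛ₁f
    -- the zero sums of `f` and `f₁` agree (the boundary zero `ρ` has weight `0`)
    have hfin₁ : {z : ℂ | f₁ z = 0 ∧ z ∈ Icc W₀ W₁ ×ℂ Icc (-H) H}.Finite :=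
      hfinK.subset fun z hz ↦ ⟨((hzero₁ z).mp hz.1).2, hz.2⟩
    have hw0 : weight W₀ H ρ = 0 := by
      obtain ⟨⟨hre₁, _⟩, ⟨him₁, him₂⟩⟩ := hρK
      by_cases htop : ρ.im = H
      · exact weight_eq_zero_of_abs_im_eq hHne (by rw [htop, abs_of_pos hH])
      by_cases hbot : ρ.im = -H
      · exact weight_eq_zero_of_abs_im_eq hHne (by rw [hbot, abs_neg, abs_of_pos hH])
      have hre : ρ.re = W₀ := by
        by_contra hne
        exact hρO ⟨⟨lt_of_le_of_ne hre₁ (Ne.symm hne), hρre⟩,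
          ⟨lt_of_le_of_ne him₁ (Ne.symm hbot), lt_of_le_of_ne him₂ htop⟩⟩
      exact weight_eq_zero_of_re_eq hre
    have hord : ∀ z ∈ Icc W₀ W₁ ×ℂ Icc (-H) H, z ≠ ρ →
        analyticOrderNatAt f z = analyticOrderNatAt f₁ z := by
      intro z hz hzρ
      have h1 : analyticOrderAt f z = analyticOrderAt ((fun w : ℂ ↦ (w - ρ) ^ m) * f₁) z :=
        analyticOrderAt_congr (hf_ev z hzρ)
      have hpow_an : AnalyticAt ℂ (fun w : ℂ ↦ (w - ρ) ^ m) z :=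
        (analyticAt_id.sub analyticAt_const).pow m
      have h2 := analyticOrderAt_mul hpow_an (hf₁_an z hz)
      have h3 : analyticOrderAt (fun w : ℂ ↦ (w - ρ) ^ m) z = 0 :=
        hpow_an.analyticOrderAt_eq_zero.2 (pow_ne_zero _ (sub_ne_zero.2 hzρ))
      unfold analyticOrderNatAt
      rw [h1, h2, h3, zero_add]
    have hZ : ∑ᶠ z ∈ {z : ℂ | f z = 0 ∧ z ∈ Icc W₀ W₁ ×ℂ Icc (-H) H},
        (analyticOrderNatAt f z : ℝ) * weight W₀ H z =
        ∑ᶠ z ∈ {z : ℂ | f₁ z = 0 ∧ z ∈ Icc W₀ W₁ ×ℂ Icc (-H) H},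
          (analyticOrderNatAt f₁ z : ℝ) * weight W₀ H z := by
      have hset : {z : ℂ | f z = 0 ∧ z ∈ Icc W₀ W₁ ×ℂ Icc (-H) H} =
          insert ρ {z : ℂ | f₁ z = 0 ∧ z ∈ Icc W₀ W₁ ×ℂ Icc (-H) H} := by
        ext z
        simp only [mem_setOf_eq, mem_insert_iff, hzero₁]
        constructor
        · rintro ⟨h0, hz⟩
          by_cases hzρ : z = ρ
          · exact Or.inl hzρ
          · exact Or.inr ⟨⟨hzρ, h0⟩, hz⟩
        · rintro (rfl | ⟨⟨_, h0⟩, hz⟩)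
          · exact ⟨hfρ, hρK⟩
          · exact ⟨h0, hz⟩
      have hρnot : ρ ∉ {z : ℂ | f₁ z = 0 ∧ z ∈ Icc W₀ W₁ ×ℂ Icc (-H) H} := fun h ↦ hf₁ρ_ne h.1
      rw [hset, finsum_mem_insert _ hρnot hfin₁, hw0, mul_zero, zero_add]
      refine finsum_mem_congr rfl fun z hz ↦ ?_
      rw [hord z hz.2 ((hzero₁ z).mp hz.1).1]
    -- the edge integrals of `f` in terms of those of `f₁`
    have hL : (∫ t in (-H)..H, Real.cos (Real.pi * t / (2 * H)) * Real.log ‖f ((W₀ : ℂ) + t * I)‖) =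
        (m : ℝ) * (∫ t in (-H)..H, Real.cos (Real.pi * t / (2 * H)) *
          Real.log ‖(W₀ : ℂ) + t * I - ρ‖) +
        ∫ t in (-H)..H, Real.cos (Real.pi * t / (2 * H)) * Real.log ‖f₁ ((W₀ : ℂ) + t * I)‖ := by
      rw [← intervalIntegral.integral_const_mul, ← intervalIntegral.integral_add]
      · exact intervalIntegral.integral_congr_ae hae₁
      · exact (hJ₁.continuousOn_mul hcp.continuousOn).const_mul _
      · exact hI₁.continuousOn_mul hcp.continuousOn
    have hT : (∫ α in W₀..W₁, Real.sinh (Real.pi * (α - W₀) / (2 * H)) *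
        Real.log ‖f ((α : ℂ) + H * I)‖) =
        (m : ℝ) * (∫ α in W₀..W₁, Real.sinh (Real.pi * (α - W₀) / (2 * H)) *
          Real.log ‖(α : ℂ) + H * I - ρ‖) +
        ∫ α in W₀..W₁, Real.sinh (Real.pi * (α - W₀) / (2 * H)) *
          Real.log ‖f₁ ((α : ℂ) + H * I)‖ := by
      rw [← intervalIntegral.integral_const_mul, ← intervalIntegral.integral_add]
      · exact intervalIntegral.integral_congr_ae hae₂
      · exact (hJ₂.continuousOn_mul hsq.continuousOn).const_mul _
      · exact hI₂.continuousOn_mul hsq.continuousOn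
    have hB : (∫ α in W₀..W₁, Real.sinh (Real.pi * (α - W₀) / (2 * H)) *
        Real.log ‖f ((α : ℂ) + ((-H : ℝ) : ℂ) * I)‖) =
        (m : ℝ) * (∫ α in W₀..W₁, Real.sinh (Real.pi * (α - W₀) / (2 * H)) *
          Real.log ‖(α : ℂ) + ((-H : ℝ) : ℂ) * I - ρ‖) +
        ∫ α in W₀..W₁, Real.sinh (Real.pi * (α - W₀) / (2 * H)) *
          Real.log ‖f₁ ((α : ℂ) + ((-H : ℝ) : ℂ) * I)‖ := by
      rw [← intervalIntegral.integral_const_mul, ← intervalIntegral.integral_add]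
      · exact intervalIntegral.integral_congr_ae hae₃
      · exact (hJ₃.continuousOn_mul hsq.continuousOn).const_mul _
      · exact hI₃.continuousOn_mul hsq.continuousOn
    have hrk : Continuous fun t : ℝ ↦ rightKernel W₀ W₁ H t := by unfold rightKernel; fun_prop
    have hR : (∫ t in (-H)..H, rightKernel W₀ W₁ H t * Λ t).re =
        (∫ t in (-H)..H, rightKernel W₀ W₁ H t * Λ₁ t).re +
          (m : ℝ) * (∫ t in (-H)..H, rightKernel W₀ W₁ H t *
            Complex.log ((W₁ : ℂ) + t * I - ρ)).re := by
      have hcongr : EqOn (fun t ↦ rightKernel W₀ W₁ H t * Λ t)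
          (fun t ↦ rightKernel W₀ W₁ H t * Λ₁ t +
            (m : ℂ) * (rightKernel W₀ W₁ H t * Complex.log ((W₁ : ℂ) + t * I - ρ)))
          (uIcc (-H) H) := by
        intro t _
        simp only [hΛ₁]
        ring
      rw [intervalIntegral.integral_congr hcongr, intervalIntegral.integral_add,
        intervalIntegral.integral_const_mul, add_re, mul_re, natCast_re, natCast_im, zero_mul,
        sub_zero]
      · exact (hrk.continuousOn.mul hΛ₁c).intervalIntegrable_of_Icc hcd.le
      · exact ((hrk.continuousOn.mul hlogc).intervalIntegrable_of_Icc hcd.le).const_mul _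
    have hlin := linear_rhs_eq_zero_of_mem_frontier hH hW hρK hρO hρre
    rw [hZ, hL, hT, hB, hR]
    linear_combination hE₁ - (m : ℝ) * hlin
end SelbergBox

/-! ### The discharge -/

/-- **Selberg's box lemma (Conrey–Soundararajan 2002, Lemma 2.1; Selberg 1946) — DISCHARGED.**
The named fact `Literature.Analysis.Complex.selbergBoxLemma` holds: for `f` entire and non-zero on
a half-plane `Re z ≥ W`, `H > 0`, `W₀ < W < W₁`, and any continuous branch `Λ` of `log f(W₁ + it)`
on `[−H, H]`,
`4H Σ_{ρ ∈ 𝓑, f(ρ)=0} m(ρ) cos(πγ/(2H)) sinh(π(β − W₀)/(2H))`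
`= ∫_{−H}^{H} cos(πt/(2H)) log|f(W₀+it)| dt + ∫_{W₀}^{W₁} sinh(π(α−W₀)/(2H)) log|f(α+iH) f(α−iH)| dα`
`  − Re ∫_{−H}^{H} cos(π(W₁ − W₀ + it)/(2iH)) Λ(t) dt`,
boundary zeros included (they carry weight `0`; the edge integrals are then improper but
absolutely convergent Lebesgue integrals). Proof: `SelbergBox.identity_split_aux` (stage 1 plus
division of the boundary zeros) and the a.e. identity `log|f(α+iH) f(α−iH)| = log|f(α+iH)| +
log|f(α−iH)|` off the finitely many horizontal-edge zeros.
[cite: ConreySoundararajan2002, §2 Lemma 2.1] -/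
theorem selbergBoxLemma_holds : selbergBoxLemma := by
  intro f W₀ W W₁ H hf hW hH h₀ h₁ Λ hΛ hΛf
  have hW' : W₀ < W₁ := h₀.trans h₁
  have hcd : -H < H := by linarith
  have hfK : AnalyticOnNhd ℂ f (Icc W₀ W₁ ×ℂ Icc (-H) H) := fun z _ ↦ hf.analyticAt z
  have hright : ∀ t ∈ Icc (-H) H, f ((W₁ : ℂ) + t * I) ≠ 0 := fun t _ ↦
    hW _ (by simpa using h₁.le)
  have h0mem : (0 : ℝ) ∈ Icc (-H) H := ⟨by linarith, hH.le⟩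
  have hKpt : ((W₁ : ℂ) + (0 : ℝ) * I) ∈ Icc W₀ W₁ ×ℂ Icc (-H) H :=
    ⟨by simpa using hW'.le, by simpa using hcd.le⟩
  have hK_top : ∀ α ∈ Icc W₀ W₁, ((α : ℂ) + H * I) ∈ Icc W₀ W₁ ×ℂ Icc (-H) H := fun α hα ↦
    ⟨by simpa using hα, by simpa using hcd.le⟩
  have hK_bot : ∀ α ∈ Icc W₀ W₁, ((α : ℂ) + ((-H : ℝ) : ℂ) * I) ∈ Icc W₀ W₁ ×ℂ Icc (-H) H :=
    fun α hα ↦ ⟨by simpa using hα, by simpa using hcd.le⟩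
  have hfin := finite_zeros_closed_reProdIm hW'.le hcd.le hfK hKpt (hright 0 h0mem)
  obtain ⟨-, hI₂, hI₃, hEQ⟩ := SelbergBox.identity_split_aux hH hW' hfin.toFinset f hfK hright
    (fun z hz h0 _ ↦ by rw [Set.Finite.mem_toFinset]; exact ⟨h0, hz⟩)
  rw [hEQ Λ hΛ hΛf]
  -- the printed product form of the horizontal term
  have hsq : Continuous fun α : ℝ ↦ Real.sinh (Real.pi * (α - W₀) / (2 * H)) := by fun_prop
  have hbot_pt : ∀ α : ℝ, (α : ℂ) - H * I = α + ((-H : ℝ) : ℂ) * I := by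
    intro α; push_cast; ring
  have hT₂ : {α : ℝ | α ∈ Icc W₀ W₁ ∧ f ((α : ℂ) + H * I) = 0}.Finite := by
    refine Set.Finite.of_finite_image (f := fun α : ℝ ↦ (α : ℂ) + H * I) ?_ ?_
    · refine hfin.subset ?_
      rintro _ ⟨α, ⟨hα, h0⟩, rfl⟩
      exact ⟨h0, hK_top α hα⟩
    · intro α _ β _ h
      simpa using congrArg Complex.re h
  have hT₃ : {α : ℝ | α ∈ Icc W₀ W₁ ∧ f ((α : ℂ) + ((-H : ℝ) : ℂ) * I) = 0}.Finite := by
    refine Set.Finite.of_finite_image (f := fun α : ℝ ↦ (α : ℂ) + ((-H : ℝ) : ℂ) * I) ?_ ?_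
    · refine hfin.subset ?_
      rintro _ ⟨α, ⟨hα, h0⟩, rfl⟩
      exact ⟨h0, hK_bot α hα⟩
    · intro α _ β _ h
      simpa using congrArg Complex.re h
  have hprod : (∫ α in W₀..W₁, Real.sinh (Real.pi * (α - W₀) / (2 * H)) *
      Real.log ‖f ((α : ℂ) + H * I) * f ((α : ℂ) - H * I)‖) =
      (∫ α in W₀..W₁, Real.sinh (Real.pi * (α - W₀) / (2 * H)) *
        Real.log ‖f ((α : ℂ) + H * I)‖) +
      ∫ α in W₀..W₁, Real.sinh (Real.pi * (α - W₀) / (2 * H)) *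
        Real.log ‖f ((α : ℂ) + ((-H : ℝ) : ℂ) * I)‖ := by
    rw [← intervalIntegral.integral_add (hI₂.continuousOn_mul hsq.continuousOn)
      (hI₃.continuousOn_mul hsq.continuousOn)]
    apply intervalIntegral.integral_congr_ae
    filter_upwards [hT₂.countable.ae_notMem volume, hT₃.countable.ae_notMem volume]
      with α h2 h3 hα
    rw [uIoc_of_le hW'.le] at hα
    have hαI : α ∈ Icc W₀ W₁ := Ioc_subset_Icc_self hα
    have hne2 : f ((α : ℂ) + H * I) ≠ 0 := fun h0 ↦ h2 ⟨hαI, h0⟩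
    have hne3 : f ((α : ℂ) + ((-H : ℝ) : ℂ) * I) ≠ 0 := fun h0 ↦ h3 ⟨hαI, h0⟩
    rw [hbot_pt α, norm_mul, Real.log_mul (norm_ne_zero_iff.2 hne2) (norm_ne_zero_iff.2 hne3)]
    ring
  rw [hprod]
  ring

end Literature.Analysis.Complex

end
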